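import Literature.MathematicalPhysics.QuantumFieldTheory.Balaban1983to89.T4LipschitzCutoff
/-!
# `Balaban1983to89.T4SiblingInsertion` — under design (η) the sibling sum is a SUB-PROBABILITY: the last
estimate-binder of the count × suppression route to NE7c, `T4LipschitzCutoff.SiblingSuppression`, holds with a
CONSTANT `S` for a STRUCTURAL reason (towers of decompositions of unity propagated by integral-preserving operations),
with NO large-field estimate — for every sibling occurrence seated at a DECOMPOSITION; the occurrences REGENERATED by the
normalising kernels of `ℝ` at the window's `ℝ`-events are isolated, typed, and priced LEVEL BY LEVEL (one ratio `r̄`, i.e.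
one floor (Y), §6 — v1.2; where the FIBREWISE floor fails — contact slots — the tower's x-INTEGRATED insertion hypothesis
`hins` is fed by a WEIGHTED floor + an AVERAGED contact bound, §7 — v1.3)

HONEST FRAMING (cell `pub-balaban/t4`, node U5b / estimate NE7c, lineage `t4-ne7c-p2`, generation 4; v1.1 = generation
5; v1.2 = generation 6; v1.3 = generation 11).  Rung (B)+1 of a
FINITE four-torus `T⁴`: the object downstream is the K-uniform Cauchy property of the cutoff generating functions
(`T4IndicatorShell.cauchy_of_relWeightBound_shell` ← `ShellWeightBound`), NOT infinite volume, NOT a mass gap, NOT the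
Clay problem.  Everything here is [folklore] finite bookkeeping (finite sums, towers indexed by `Fin ℓ → Fin b`, two
Bochner-integral lemmas); NO statement of Bałaban's papers is asserted, NO Literature fact is introduced, and every
analytic input of the cell's scheme stays a NAMED BINDER of the theorems that use it: the coupling-flow hypotheses
(`BetaPertH`, (B), (B^μ) — not even mentioned by the theorems below, they enter only through the cell's upstream nodes),
positivity of the dressed densities (cell docket L1-pos), the dressed scheme H2, the two-run width `Summable ρ` (node
U1b/U4′).  The manuscripts under audit are quoted for their DEFINITIONS and NORMALISATION IDENTITIES only (page + render
id), never for a disputed estimate.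

v1.1 (generation 5) = v1 (p186555) with §1–§4 BYTE-IDENTICAL, plus (a) the documentation fixes of the cross-read
`t4/T4-XREAD-SiblingInsertion-v1.md` (t4-ne7-p2 gen 4; GAPS C-ne7p2-6 / D-ne7p2-6a) in this header — F-1 (which
large-field components exit (B1) hands to NE7b: the window ENLARGED by print's renormalization delay `N`), L-1 (B12
locator = render, and the printed unity (0.15) under (S-f)), M-1 (schedule / history-dependent insertion level), M-2
(a tower level is a WHOLE generating step), D-1 (a.e. positivity) — and (b) the append-only §5 (a.e. forms of §4; the
STOPPED sub-tower bound).  The node owner pv07 recorded rule R-η-4 (`CLAIMS.log` l.50896): the (η) instantiation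
follows exit (B1), and its socket leaf `T4LipschitzLedgerSocket` (p186782) consumes `siblingSuppression_of_towerBound`
BY NAME — so (B2) below is the documented alternative, not the served path, and no (B2) lemma is added.

v1.2 (generation 6) = v1.1 (p187054) with §1–§5 BYTE-IDENTICAL, plus (a) in this header the ANSWER to GAPS G-ne7bp1g5-1
(t4-ne7b-p1 gen 5; kernel `T4BadClassBooking`, p187370; journal NOTE l.51648): CONCEDED IN FULL — exit (B1) below is
WITHDRAWN as a device (it hands NE7b an ALL-YOUNG class, whose relative weight is `K`-uniform:
`T4BadClassBooking.not_relWeightBound_of_saturated`), the corrected accounting (B′) replaces it, and v1.1's sentence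
«under (B1) the EXISTENCE path of NE7c-(η) carries no large-field estimate in the sibling binder at all» is withdrawn
with it; the cross-read remarks I-5 (`t4/T4-XREAD-SiblingInsertion-v1.1-delta.md`, t4-ne7-p2 gen 5: print's
renormalization delay is COUPLING-TIED, not a «printed constant») and R3 (`t4/T4-XREAD-SiblingInsertion-v1.1.md`, pv10
gen 16: that delay, written `N` in B15, is NOT the window parameter `N` of `T4LipschitzCutoff.Window N n` — below it is
written `N_R`); and (b) the append-only §6: the REGENERATED class priced level by level
(`siblingSuppression_of_levelTowerBounds`, `siblingSuppression_of_towerBound_add_levels`), the one estimate it costs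
typed as the hypothesis shape (Y) `SmallFieldFloor` / `UniformSmallFieldFloor` with `integral_mul_le_inv_floor`
(`r ≤ 1/c`), the (η) constructor at `S a = s + d(a)·r` and its total.  pv07's rule R-η-4 («the (η) instantiation follows
exit (B1)») is thereby known to need the amendment «`ℝ`-events of the window priced by (B′)» — a NOTE of this
generation; the ledger `t4/T4-EST-U5bE2.md` and the socket leaf are pv07's and are not touched.

v1.3 (generation 11) = v1.2 (ledger p187459) with §§1–6 BYTE-IDENTICAL IN CODE (the 68 declaration records of v1.2 are a
verbatim prefix of this file's declaration records; checked mechanically before proposing), plus ONE NEW APPEND-ONLY SECTION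
§7 «the fibrewise floor's domain of validity (contact slots) and the x-AVERAGED producer for `hins`», REQUESTED by the node
owner (lineage pv07, generation 17: cell journal `CLAIMS.log` 2026-08-19T15:29:02Z; GAPS G-pv07-9 ⟦UPDATE pv07-g17⟧; the
owner's record `t4/T4-EST-U5bE2.md` v2.6 §19.3) after this lineage's generation-10 finding (GAPS G-ne7cp2-8d / C-ne7cp2-18;
record `t4/T4-EST-NE7c-P2.md` §15), which the owner ACCEPTED: the fibrewise floor (Y) `UniformSmallFieldFloor` of §6 — ONE
constant `c > 0` for EVERY fibre, i.e. for every exterior pinning — is this cell's SUFFICIENT producer of the tower's insertion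
hypothesis `hins` (§4–§5), and it is FALSE on any fibre family whose slot factor is uniformly small on fibres of positive mass
(§7 `not_uniformSmallFieldFloor_of_vanishing_profiles`; in the cell's cube model of the regenerated small-field factors these
are the «contact slots»: a slot whose read set meets cubes outside the small-field region, where an admissibly pinned exterior
can sit arbitrarily close to the slot's threshold).  The tower's `hins` compares x-INTEGRATED masses; it survives there through
a WEIGHTED floor (the constant scaled by a weight `w(x) ∈ (0, 1]`, e.g. the contact cubes' own factor) together with an
AVERAGED contact bound `∫ M/w dm ≤ C·∫ M dm` over the exterior, giving `hins` with `r̄ = C/c` (§7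
`integral_mass_ratio_le_of_weightedFloor`; `r̄ = 1/c` back when `w ≡ 1`, `C = 1`).  §7 is this lineage's generation-10 scratch
kernel carried into the tree verbatim modulo naming: [folklore] Bochner-integral algebra over the §6 shapes; the weighted floor
and the averaged contact bound are HYPOTHESIS SHAPES, NOT PRINTED, asserted nowhere (the owner books them as the class-(v)
producer of its re-scoped owed estimate G-pv07-9, species E2REL-b).  Whether contact slots occur AT ALL among the factors the
normalising kernels of `ℝ` regenerate is a READING QUESTION on [B15] §1 (the cell's Qσ; GAPS G-ne7cp2-8d, C-ne7cp2-20), open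
at the time of writing and NOT decided by this file — §7 is model-free and serves either answer.  Nothing of §§1–6 is
re-worded; the one-writer notes below are unchanged but for §7's line.

## §0 What this file says, exactly

THE BINDER.  `T4LipschitzCutoff.SiblingSuppression l₀ T X N n sibXs S` (tree, l.593): for every slot `σ = ⟨a, i⟩` of the
window, every cutoff `K` and `|t| ≤ l₀`, `Σ_{τ ∈ T K} sibXs σ K t τ ≤ S a · Σ_{τ ∈ T K} X K t τ` — the σ-SIBLING WEIGHTS
(the run's terms with the slot's profile factor replaced by its shell indicator, realized as `T4LipschitzLedger.sibW`)
against the run's own partition function.  It is `hSA`/`hSB` of `T4LipschitzLedger.shellWeightBound_of_repr` /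
`cauchy_of_repr` (pv07) and of `T4LipschitzCutoff.shellWeightBound_of_lipProfile` (this lineage, v1.3); the records
(`t4/T4-EST-U5bE2.md` §6.3/§8.4, `t4/T4-EST-NE7c-P2.md` §6) priced it as "NE7b species, per age, with `e^{−p₀}`".

THE OBSERVATION (generation 4).  No suppression is needed for the DECOMPOSITION occurrences [v1.2: the regenerated ones
cost the floor (Y), §0 (B′) / §6].  The run's expansion is GENERATED by (S-a) pointwise
DECOMPOSITIONS OF UNITY inserted cube by cube and (S-b)/(S-c) INTEGRAL-PRESERVING positive linear operations (`T`, and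
`ℝ`/`ℝ′` branch by branch), applied to (S-d) NONNEGATIVE densities, and (S-e) the quantity at the end is the TOTAL
integral (dressed scheme: the observable sits in the initial density).  Hence the masses of PARTIAL HISTORIES form a
CONSERVING TOWER (`ConservesOn`), and the σ-modified family — the slot's factor replaced by shell indicators totalling
`≤ s` pointwise at the slot's level, every later operation unchanged — is a SUB-conserving tower dominated at insertion by
`s ×` the parent (`levelSum_le_of_insertion`): `Σ_τ sib_σ ≤ s · Z_K(t)` with `s = 2` (the two polarities' shells of rules
R-η-1/R-η-2 overlap on the layer `[(1−κ)θ, θ)`, each `≤ 1`; `s = 1` per polarity).  NO smallness, NO `e^{−p₀}`, NO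
`T4ShellCount.LevelGain`; the band-weight total becomes `Σ_K Wsh_K = s · C₀(n, L) · Σ_j ρ_j` (`tsum_weight_const`):
under design (η) the summability of the shell weights IS the summability of the two-run width `ρ` and nothing else.

THE FORMAT AND ITS HONESTY.  The hypothesis shape handed to the instantiating seat is `TowerBound s Z Y` (§3); it is a
PROOF FORMAT, logically equivalent to `Y ≤ s·Z` (`towerBound_iff_le`) — its content is the ROUTE: exhibit the partial
integrands of the run's expansion on their level spaces and check ONE-STEP identities (`towerBound_of_integralTower`,
§4; discrete model `towerBound_of_generator`, §2).  Per `(σ, K, t)` the seat shows: (i) unity of each elementary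
decomposition (S-a); (ii) the one-step identity `∫ ρ(ℓ+1)(h,c) dμ(ℓ+1) = ∫ φ_c · ρ ℓ h dμ ℓ` for each later operation
((S-b), (S-c), (S-f)); (iii) at the slot's level the insertion inequality with `ψ_c` = the polarity shells (`≤ 1` each,
`T4LipschitzLedger.Pol.shell_le_one`); (iv) `Σ_τ X K t τ = levelSum (∫ρ) L` and `Σ_τ sibW σ K t τ ≤ levelSum (∫ρ') L`
(bookkeeping of its own `TermRepr`).  Then `siblingSuppression_of_towerBound` gives `S ≡ 2` and
`shellWeightBound_of_towerBound` the literal `ShellWeightBound`.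
[v1.1 — XREAD M-2, M-1, D-1.]  WHAT A LEVEL IS (M-2): one tower level = ONE ELEMENTARY GENERATING OPERATION of the
seat's own bookkeeping — one decomposition of unity on one cube / component, or ONE WHOLE integral-preserving operation
(the renormalization transformation (0.1)/(0.13) of a step together with its gauge-fixing unities, one `ℝ`, one `ℝ′`) —
and NOT the one-step factors of print's a-posteriori factorization B14 p. 258 «For a given large field region X the
operation 𝐓_k(X) can be factorized into a product of one-step operations, and has the form 𝐓_k(X) = ∏_{j=k−1}^{0}
𝐓^{(j)}(Z_{j+1}∩X). (2.20)», whose factors carry region-dependent characteristic functions and a Gaussian fluctuation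
integral (2.21) and are conditional on the history: «If the operation 𝐓^{(j)} is changed by an 𝐑-operation, then the
general form (2.21) is preserved, but the characteristic functions are changed, and the domain Z_{j+1}∩Ω_{j+1}∩X may be
empty.» [render `1988-cmp119-convergent-renormalization-p016`, read as image] — such pieces are not separately
normalised; conservation (`hstep`, unity) is checked for the WHOLE step, which is what (0.4)/(1.102) and reading R-T
state.  THE SCHEDULE (M-1): §3–§4 insert the slot's factor at ONE level `ℓσ` for all histories, while print introduces
its decompositions «in each component of Z separately» (B15 p. 181) and `ℝ` acts history by history; EITHER the seat
fixes a history-independent SCHEDULE (level ↔ (step, sub-operation, cube, threshold); the trivial decomposition `φ₀ = 1`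
on histories where print does nothing at that level; `ψ_{h,c} = 0` on histories not containing the slot — allowed, `ψ`
is `h`-indexed), OR it uses the STOPPED form of §5 (`levelSum_le_of_stoppedInsertion`,
`towerBound_of_stoppedIntegralTower`): a waiting/active status per node, insertion wherever the history meets the slot,
at most once per root-to-leaf path, same conclusion `Σ sib ≤ s · Z`.  POSITIVITY (D-1): `TermRepr.rem_nonneg` is a
`μ`-a.e. statement; §5 restates §4 with unity, insertion and parent positivity `μ ℓ`-a.e.
(`towerBound_of_integralTower_ae`); §4's everywhere forms remain (special case).

(A)/(B): WHICH OCCURRENCES ARE COVERED — the one caveat, typed.  A sibling replaces ONE OCCURRENCE of the slot's profile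
factor in a term.  (A) Occurrences INSERTED BY A DECOMPOSITION and carried by later operations whose kernels do not
contain the factor: covered structurally (mechanism (A), `insertion_mass_le`, constant `s = 2`).  (B) Occurrences
REGENERATED BY A NORMALISING KERNEL: the `ℝ`-operation replaces the large-field expression on a renormalised region `Z′`
by "the corresponding small field expression" (B15 p. 176), i.e. the `Z`-branch (`Z = Z′ ∪ Z″`, `Z′ ≠ ∅`) is mapped by the
history-dependent MARKOV KERNEL `P(x, y) = ρ(Z″; y_{Z′}, x_{Z′ᶜ}) / ∫dV⌈_{Z′} ρ(Z″; ·, x_{Z′ᶜ})` (rows integrate to `1`: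
this is (0.3) read branch-wise), and this kernel CONTAINS the small-field profile factors `p_σ(u_σ(y_{Z′}))` of the cubes
`σ ⊂ Z′` of the `Z″`-history.  Replacing such a regenerated occurrence by its shell modifies the KERNEL, whose row sums
become the RATIO `r = ∫_{Z′} shell_σ · rest″ / ∫_{Z′} p_σ · rest″` — NOT bounded structurally (mechanism (B),
`kernelMod_mass_le`, constant `r`).  WHEN DOES (B) OCCUR?
[v1.2 — corrected; v1/v1.1 answered «only under print's MERGED indexation», which is wrong:] at EVERY `ℝ`-event of the
window whose `Z′ ∋ σ`, under every indexation.  Under the merged indexation — B15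
(0.5)–(0.6) «(ℝρ)(V) = Σ_{Z″} ρ(Z″, V) exp Σ_X ℝ(X, V). (0.6)», B14 (2.23) «A_k(1/g_k², U_k) = −A(1/g_k², U_k) + 𝐄_k(U_k)
+ 𝐑_k(U_k) + 𝐁_k(U_k, A) − E_k» [render `1988-cmp119…-p016`] — the reshaped `Z ⊋ Z″` branches are exponentiated INTO the
surviving small-field term, so a GOOD term's declared factor `p_σ(u_σ)`, `σ` of age `a`, has regenerated companions at
every later `ℝ`-level of the window whose `Z′ ∋ σ`; under the un-merged indexation (0.3) the image term
`ρ(Z″, V) · q_Z(V⌈_{Z′ᶜ})` of the `Z`-branch carries the substituted factor `p_σ(u_σ(V))`, `σ ⊂ Z′`, EXPLICITLY, and as a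
GOOD term it must DECLARE it (a profile factor left in the remainder `RX` defeats the remainder sandwich `hsw` of
`T4LipschitzLedger.core_sandwich` near the threshold, where the two runs' profile values are not multiplicatively
comparable) — its sibling is mechanism (B) with the same ratio `r`.  [v1.2] THE STATUS OF v1.1's TWO EXITS:
 (B1) [v1/v1.1: «UN-MERGED INDEXATION … keep every `ℝ`-reshaped branch (`Z′ ≠ ∅` at some window level) as a separate
   term of `Bad K t` with NO declared factors …; their total weight is what NE7b's `RelWeightBound` binds ON THE WINDOW
   ENLARGED BY PRINT'S RENORMALIZATION DELAY»] — WITHDRAWN (GAPS G-ne7bp1g5-1, CONCEDED).  NE7b's binder is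
   `T4WeightBudget.RelWeightBound l₀ T A B Bad W` (fields `bad_subset`, `nonneg`, `lt_one`, `summable`, `bad_left`,
   `bad_right`; the name «`T4LipschitzCutoff.RelWeightBound l₀ T X N n relW B`» used in GAPS G-ne7cp2-7 was a phantom,
   and the type has NO age parameter — v1.4 of the record erred on both), and its field `summable : Summable W` cannot
   hold for a class whose relative weight stays above a fixed fraction along infinitely many `K`
   (`T4BadClassBooking.not_relWeightBound_of_saturated`; booking rule `not_relWeightBound_of_subset_saturated`).  That
   is the case of the ALL-YOUNG `ℝ`-reshaped branches — event level in the live window and no pending component of age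
   `≥ K − j⋆(K)`: the region `Z′` consists of the components that require a renormalization (B15 p. 176 «Z″ is a union
   of components of the region Z, for which the small factors connected with large field control some number of next
   steps, Z′ is a union of remaining components, i.e. components for which the corresponding expressions require a
   renormalization.» [render `1989-cmp122-large-field-I-p002`]), admitted only under p. 177 «(ii) in the preceding N
   renormalization steps no new large field regions were created inside this component, and the previous regions
   contained in it satisfy the condition (i) on the corresponding scales.» [render `…-p003`], so their ages are bounded
   by `N_w + N_R` INDEPENDENTLY of `K` — `N_w` = the window parameter `N` of `T4LipschitzCutoff.Window N n`; `N_R` =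
   print's renormalization delay, written `N` in B15, a COUPLING-TIED parameter and not a printed constant [v1.2, XREAD
   I-5 / R3]: B15 p. 179 «Take the smallest positive integer N₀ such, that L^{−N₀+1}MR_{k−N₀+1} = M. It is easy to see
   that either there is exactly one such integer, or there are two. We assume that N > N₀, in fact it will become clear
   later that N is much greater than N₀.» [render `1989-cmp122-large-field-I-p005`, read as image], `K`-independent on
   the young band under cell reading U5a — and their relative weight is the `K`-UNIFORM budget
   `V · Σ_{a ≤ N_w + N_R} Λ^a e^{−p a}` (`T4BadClassBooking.AgeCover.bad_le_uniform` — `T4ShellCount` §2, this lineage's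
   own wall `not_summable_ageWeight_of_ageOnly`, transported from `Wsh` to `W`).  An `ℝ`-reshaped branch that DOES
   contain an old pending component is in NE7b's `Bad K t` by NE7b's own definition, reshaped or not.  So (B1) hands
   NE7b nothing it does not already own and nothing it can additionally absorb: as a device it is VOID (and with it
   G-ne7cp2-7's «constants only»).
 (B′) [v1.2 — replaces (B1); = v1.1's (B2) made precise and LEVEL-WISE:] the regenerated σ-occurrences are priced level
   by level.  At a later `ℝ`-level `ℓ` of the window the σ-regenerated family — the `Z`-branches alive at level `ℓ` with
   `σ ⊂ Z′`, pushed through the σ-MODIFIED kernel, every later operation unchanged — is ITSELF a tower-bound datum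
   `TowerBound r̄ Z Y_ℓ` of §3–§5 (insertion AT LEVEL `ℓ` with `ψ_{h,c} = r_Z · φ_c ≤ r̄ · φ_c` on the reshaped choices,
   `0` elsewhere; `Σ_c ψ ≤ r̄`), so `Y_ℓ ≤ r̄ · Z_K(t)`; a slot of age `a` sees at most `d(a)` such levels (`d(a) = a` with
   one `ℝ` per step); hence `SiblingSuppression` holds with `S a = s + d(a) · r̄` (§6
   `siblingSuppression_of_levelTowerBounds`, `siblingSuppression_of_towerBound_add_levels`; `s = 2` structural for the
   decomposition occurrences as before, `r̄` summed over the slot's polarities like `s`).  `S` is AGE-DEPENDENT but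
   `K`-UNIFORM — all the binder asks — and the band-weight total stays `Σ_K Wsh_K = C₀(n, L·S) · Σ_j ρ_j` (§6
   `tsum_weight_add_levels`): the summability of the shell weights is STILL the summability of `ρ` alone.  THE PRICE is
   ONE estimate, typed in §6 as the hypothesis shape (Y) `SmallFieldFloor` / `UniformSmallFieldFloor`: a ONE-CUBE
   CONDITIONAL SMALL-FIELD FLOOR `c · ∫_{Z′} rest″ ≤ ∫_{Z′} p_σ · rest″` with ONE `c > 0` for all `(K, t, ℓ, Z, σ, x_{Z′ᶜ})`;
   then `r̄ = 1/c` (§6 `integral_mul_le_inv_floor`, shell `≤ 1`; for the small polarity `r` is moreover the conditional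
   odds of the LOWERED-threshold large-field event, the shell being dominated by that indicator,
   `T4LipschitzLedger.Pol.shell_small_le_largeInd_lowered`).  (Y) says: under `ℝ`'s exterior-pinned substituted density
   on `Z′` the cube `σ` meets its small-field condition with conditional probability `≥ c`.  Printed MECHANISM: B15
   p. 176 «The quotients are still small, because some small factors in the regions Z′ are left for the densities in the
   numerator.» [render `1989-cmp122-large-field-I-p002`]; cell SPECIES: E2REL-b / the catalogued NE7b-at-lowered-threshold
   template; NOT PRINTED as such; an ESTIMATE, not structure — owed to the (η) route by the `TermRepr`-instantiating seat,
   species owners the E2REL-b / NE7b lineages.  The SAME floor is what the remainder sandwich `hsw` needs for the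
   two-run comparability of `ℝ`'s DENOMINATORS `∫_{Z′} p · rest″` inside the image / merged GOOD terms (additive profile
   closeness `L_χ ρ` becomes multiplicative only against a floor) — node U5b/U5c's «remnant leaves» binder, named here,
   not this file's.
Under (B′) the EXISTENCE path of NE7c-(η) carries exactly ONE large-field-type estimate in the sibling binder, (Y),
entering a `K`-uniform CONSTANT (`r̄ = 1/c`) and never a summability; `e^{−p₀}` enters the every-`K` smallness of the
band weight (honest label, `t4/T4-EST-U5bE2.md` §6.5/§8.3) and the size of `c` — nothing else of this file changes.

## §0′ Dictionary: the model ↔ the printed generating operations (quotations = definitions / identities only)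

(S-a) DECOMPOSITIONS OF UNITY, cube by cube, history-dependent — `d ℓ h c` / `φ ℓ h c` with `Σ_c ≡ 1`:
  B15 p. 181 «We start with the decomposition of unity 1 = χ_k^{(0)} + (1 − χ_k^{(0)}), where» (1.22) [render
  `1989-cmp122-large-field-I-p007`]; p. 183 «Introduce the decomposition of unity 1 = χ′_j + (1 − …» [`…-p009`]; p. 193
  «unity 1 = χ_{k,Λ} + (1 − χ_{k,Λ})» (1.75) [`…-p019`]; the terms: B14 p. 257 (2.17)–(2.18) «ρ_k(V_k) = Σ_{{Ω_j},{Λ_j}}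
  χ_k(Ω_k) 𝐓_k({Ω_j},{Λ_j}) exp A_k(1/g_k², U_k), (2.18) where the summation is over the admissible sequences of domains.»
  and «Basically this operation is a composition of integrations restricted to large field regions in successive scales,
  and multiplications by characteristic functions, δ-functions defining renormalization transformations, and gauge fixing
  expressions.» [renders `1988-cmp119-convergent-renormalization-p015`, `…-p016`].  Under design (η) the characteristic
  functions of the window are the Lipschitz profiles `p^small + p^large = 1` (`T4LipschitzCutoff.LipProfile`, rules
  R-η-1/R-η-2 of `t4/T4-EST-U5bE2.md` §5) — still decompositions of unity.  A non-branching operation is the trivial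
  decomposition (`φ_0 = 1`, the other `φ_c = 0`); constant-weight averages (the `1/N_i Σ` over graphs of B15 (1.100)) are
  decompositions of unity with constant weights.
(S-b) THE RENORMALIZATION TRANSFORMATION `T` — a positive linear integral operator with a kernel integrating to one over
  the new variable: B14 p. 243 «(Tρ)(V) = ∫dUδ(ŪV⁻¹)ρ(U), (0.1) where ρ(U) is a function of the gauge field variables U
  on a lattice T, Ū is the averaged field on the lattice T⁽¹⁾, and V is a new gauge field on the lattice T⁽¹⁾.» [render
  `1988-cmp119-…-p001`]; B12 p. 254 «Now we consider renormalization transformations, which have the general form (Tϱ)(V) =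
  ∫dUt(V,U)ϱ(U). (0.13) Here U, V are gauge field configurations on the lattices T, T⁽¹⁾ correspondingly, and t(V,U)
  is a gauge invariant kernel, for example see the definitions in [9,12].» [render `1987-cmp109-rg-I-small-field-p006`,
  read as image — v1.1, XREAD L-1; v1 cited the text layer].  READING R-T (flagged for the cell's cross-reader):
  `∫dV (Tρ)(V) = ∫dU ρ(U)` by Fubini and the unit mass of the group δ-function `∫dV δ(ŪV⁻¹) = 1` (normalised Haar
  measure) — print does not spell this sentence out at (0.1); it is the `Σ_y P x y = 1` / `hstep` of the model.
(S-c) THE OPERATIONS `ℝ`, `ℝ′` — integral-preserving, branch by branch: B15 p. 176 «a large field expression is replaced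
  by the corresponding small field expression in such a way, that integrals of the densities are unchanged.», «(ℝρ)(V) =
  Σ_Z ρ(Z″, V) ∫dV⌈_{Z′}ρ(Z, V) / ∫dV⌈_{Z′}ρ(Z″, V). (0.3)», «It satisfies the basic normalization property ∫dV(ℝρ)(V) =
  ∫dVρ(V). (0.4)» [render `1989-cmp122-large-field-I-p002`]; p. 200 «We have obtained a density, which may not be equal
  to ρ_k, but is equivalent to it, in the sense that they have equal integrals.» [`…-p026`]; p. 201 (1.100)–(1.102) «The
  above operation has the fundamental normalization property ∫dV_k(ℝ′ρ_k)(V_k) = ∫dV_kρ_k(V_k). (1.102)» [`…-p027`].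
  READING R-ℝ (flagged): print states the TOTAL (0.4)/(1.102); the BRANCH-WISE identity `∫dV ρ(Z″,V)·q_Z(V⌈_{Z′ᶜ}) =
  ∫dV ρ(Z,V)` (`q_Z` = the quotient of (0.3), a function of `V⌈_{Z′ᶜ}`) is Fubini on (0.3), and exhibits `ℝ` on the
  `Z`-branch as the Markov kernel of §0(B).
(S-d) NONNEGATIVITY — `hm₀`, `hd0`, `hP0`, `hρ0`: B15 p. 176 «We will prove that the densities are positive, and the
  inegration domains in the integrals above are nonempty, hence the denominators are positive, and the operation ℝ is well
  defined.» [`…-p002`] — print's claim for the UNDRESSED densities of one run; for the cell's DRESSED densities it is the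
  docket L1-pos (GAPS G-adv3-2a), a binder, not used as a fact.
(S-e) THE DRESSED SCHEME H2 (`T4-DAG.md` §0; NOT PRINTED — print is undressed: B14 p. 243–244 «we construct a sequence of
  effective densities {ρ_k} by applying successively the operations ℝT to the initial density ρ₀ = exp[−(1/g₀²)A − E]»,
  «ρ_k = ℝTρ_{k−1} = (ℝT)^k ρ_0 , (0.2)» [`1988-cmp119-…-p001`, `…-p002`]): the observable insert multiplies `ρ₀` (level `0`,
  `m₀` of the model) and the cutoff-`K` partition function is the TOTAL integral of the final density — the root identity
  `levelSum_eq_root` / `levelSum_integral_eq_root`.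
(S-f) IDENTITY REWRITES (translations to background fields, gauge-fixing insertions for gauge-invariant integrands —
  themselves PRINTED UNITIES: B12 p. 254 «It is convenient to introduce simultaneously restrictions on the variables
  U(y,x). We have the following identities for y ∈ T⁽¹⁾, x ∈ B(y), x ≠ y, (1/z)∫du(x) exp[−(1/α)[1 − Re tr
  U(y,x)u⁻¹(x)]] χ({|U(y,x)u⁻¹(x) − 1| < ε₀}) = (1/z)∫du(x) exp[−(1/α)[1 − Re tr u(x)]] χ({|u(x) − 1| < ε₀}) = 1,
  (0.15)» [render `1987-cmp109-rg-I-small-field-p006`; v1.1, XREAD L-1] (a factor of total integral `1` inserted under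
  the step's integral: the trivial decomposition `φ₀ = 1` of the tower) —, averaging over graphs, localization / polymer
  expansion / exponentiation B15 p. 176 «we write a polymer expansion, and then we exponentiate it» (0.5)–(0.6)) change
  the INDEXATION of terms, not the functions: in the tower they are trivial
  decompositions or MERGES (the format only compares TOTALS: `Z = levelSum M L`, `Y ≤ levelSum Msib L`).  Their validity
  for the σ-modified family (shell indicator inside the support of the slot's small-field condition, bounded by `1`, gauge
  invariant) is READING R-η-1's standing species (`t4/T4-EST-U5bE2.md` §5), not a new assumption — EXCEPT `ℝ` itself, whose
  substituted small-field expressions ((0.3), merged or not (0.6)) create the regenerated occurrences of §0(B) [v1.2].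

## Contents (all [folklore]; `import T4LipschitzCutoff` only; no `sorry`)

§1 TOWER CALCULUS on histories `Fin ℓ → Fin b`: `levelSum`, `ConservesOn`, `SubconservesOn`, `sum_histories_succ`,
   the backward collapse `levelSum_eq_of_conservesOn` / `levelSum_eq_root`, the forward decay
   `levelSum_le_of_subconservesOn`, THE SUB-TOWER BOUND `levelSum_le_of_insertion`.
§2 THE GENERATOR (discrete model on a finite configuration space): `dens`, `mass`, `conservesOn_mass` (unity + stochastic
   kernels ⇒ conservation), `dens_eq_of_agree`, the one-level modification inequality `modify_mass_le`, mechanism (A)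
   `insertion_mass_le`, mechanism (B) `kernelMod_mass_le`, the model theorem `levelSum_mass_modify_le` (+ `_insert_le`,
   `_kernelMod_le`), `levelSum_mass_eq_total`.
§3 THE BRIDGE: `TowerBound` (format) / `le_of_towerBound` / `towerBound_iff_le` (honesty) / `towerBound_of_generator`;
   `siblingSuppression_of_towerBound'` (age-dependent `S`), `siblingSuppression_of_towerBound` (`S ≡ s`),
   `siblingSuppression_add` ((A)+(B) classes); THE (η) CONSTRUCTOR AT CONSTANT SIBLING FACTOR
   `shellWeightBound_of_towerBound` (= `shellWeightBound_of_lipProfile` with both sibling binders discharged by tower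
   data); the totals `tsum_weight_const` (`= s · C₀(n,L) · Σ'ρ`), `summable_weight_const`,
   `tsum_weight_const_le_of_cubeCount` (`≤ s · V · Σ_{a≤N} Λ^a L(a) · Σ'ρ`).
§4 THE INTEGRAL TOWER (Bochner): `sum_integral_mul_eq_of_unity`, `sum_integral_mul_le_of_le`, `conservesOn_integral`,
   `subconservesOn_integral`, `towerBound_of_integralTower` (the shape the `TermRepr`-instantiating seat meets),
   `levelSum_integral_eq_root`.
§5 [v1.1, append-only] THE A.E. FORMS AND THE STOPPED INSERTION: `sum_integral_mul_eq_of_unity_ae`,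
   `sum_integral_mul_le_of_le_ae`, `conservesOn_integral_ae`, `subconservesOn_integral_ae`,
   `towerBound_of_integralTower_ae` (D-1); `levelSum_le_of_stoppedInsertion` (history-dependent insertion level, M-1),
   `levelSum_le_of_insertion_of_stopped` (v1's bound = the fixed schedule), `towerBound_of_stoppedInsertion`,
   `towerBound_of_stoppedIntegralTower`.
§6 [v1.2, append-only] THE REGENERATED CLASS PRICED: `siblingSuppression_of_levelTowerBounds` (`S a = d(a)·r`),
   `siblingSuppression_of_towerBound_add_levels` (`S a = s + d(a)·r`), the floor (Y) `SmallFieldFloor` (`.mono`,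
   `smallFieldFloor_one`), `integral_mul_le_inv_floor` (`r ≤ 1/c`), `UniformSmallFieldFloor` (`.integral_mul_le`), the
   constructor `shellWeightBound_of_towerBound_add_levels`, the totals `tsum_weight_add_levels` /
   `tsum_weight_add_levels_le_of_cubeCount`, consistency `lipWeight_add_levels_zero`.
§7 [v1.3, append-only] CONTACT SLOTS AND THE x-AVERAGED PRODUCER: `smallFieldFloor_le_of_profile_le` (on a fibre of
   positive mass whose factor is `≤ η` pointwise every floor constant is `≤ η`),
   `not_uniformSmallFieldFloor_of_vanishing_profiles` (factors uniformly small on fibres of positive mass ⇒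
   ¬ `UniformSmallFieldFloor … c` for EVERY `c`); the hypothesis shape `WeightedSmallFieldFloor` (NOT PRINTED) with
   `WeightedSmallFieldFloor.integral_mul_le` (row sum `≤ (w·c)⁻¹`), `ratio_le_inv_of_weightedFloor`,
   `integral_mass_ratio_le_of_weightedFloor` (weighted floor for every exterior + averaged contact bound ⇒ the tower's
   `hins` with `r̄ = C/c`); four control `example`s (the caricature inhabited; each fibre alone floored; the weighted
   floor inhabited; `w ≡ 1`, `C = 1` returns (Y)'s `r̄ = 1/c`).

One-writer note: this leaf touches no other lineage's file; it imports `T4LipschitzCutoff` (this lineage, frozen v1.3)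
and names `T4LipschitzLedger` / `T4IndicatorShell` (pv07), `T4WeightBudget.RelWeightBound` (pv14), `T4BadClassBooking`
(t4-ne7b-p1), L1-pos, H2 in prose only.  v1.3 (§7) additionally names, in prose only, the owner's later leaves
`T4TermReprCoupling` / `T4AveragingDisintegration` / `T4WindowLevelShift` and record `t4/T4-EST-U5bE2.md` (pv07), and
this lineage's own later leaves `T4SmallFieldFloorCount` / `T4SmallFieldFloorMoment` / `T4SmallFieldFloorBlockCount`,
which IMPORT this file and are untouched by an append-only section.
-/

noncomputable section

open Finset _root_.Filter _root_.Topology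

namespace Literature.MathematicalPhysics.QuantumFieldTheory.Balaban1983to89.T4SiblingInsertion

open T4IndicatorShell T4ShellCount T4LipschitzCutoff

/-! ## §1 The tower calculus: masses of partial histories, conservation, the sub-tower bound -/

section Tower

variable {b : ℕ}

/-- THE LEVEL SUM of a family of partial-history masses: `Σ_{h : Fin ℓ → Fin b} F ℓ h` — the total mass carried by
all histories of length `ℓ` (choice alphabet `Fin b`). [folklore] -/
def levelSum (F : (ℓ : ℕ) → (Fin ℓ → Fin b) → ℝ) (ℓ : ℕ) : ℝ := ∑ h : Fin ℓ → Fin b, F ℓ h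

/-- CONSERVATION between levels `ℓ₁ ≤ ℓ < L`: the mass of a history is the sum of the masses of its one-step
extensions `Fin.snoc h c`. (In the model of §2 this is decomposition of unity followed by an integral-preserving
propagation; here it is the abstract bookkeeping shape.) [folklore] -/
def ConservesOn (F : (ℓ : ℕ) → (Fin ℓ → Fin b) → ℝ) (ℓ₁ L : ℕ) : Prop :=
  ∀ ℓ, ℓ₁ ≤ ℓ → ℓ < L → ∀ h : Fin ℓ → Fin b, F ℓ h = ∑ c : Fin b, F (ℓ + 1) (Fin.snoc h c)

/-- Conservation restricts to sub-ranges of levels. [folklore] -/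
theorem ConservesOn.mono {F : (ℓ : ℕ) → (Fin ℓ → Fin b) → ℝ} {ℓ₁ L ℓ₁' L' : ℕ} (hF : ConservesOn F ℓ₁ L)
    (h₁ : ℓ₁ ≤ ℓ₁') (h₂ : L' ≤ L) : ConservesOn F ℓ₁' L' :=
  fun ℓ hℓ hℓ' h => hF ℓ (h₁.trans hℓ) (lt_of_lt_of_le hℓ' h₂) h

/-- SUB-CONSERVATION between levels `ℓ₁ ≤ ℓ < L`: the one-step extensions of a history carry AT MOST its mass (all the
upper bound below needs of the MODIFIED family: later operations that do not increase total mass). [folklore] -/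
def SubconservesOn (F : (ℓ : ℕ) → (Fin ℓ → Fin b) → ℝ) (ℓ₁ L : ℕ) : Prop :=
  ∀ ℓ, ℓ₁ ≤ ℓ → ℓ < L → ∀ h : Fin ℓ → Fin b, ∑ c : Fin b, F (ℓ + 1) (Fin.snoc h c) ≤ F ℓ h

/-- Conservation ⇒ sub-conservation. [folklore] -/
theorem ConservesOn.subconservesOn {F : (ℓ : ℕ) → (Fin ℓ → Fin b) → ℝ} {ℓ₁ L : ℕ} (hF : ConservesOn F ℓ₁ L) :
    SubconservesOn F ℓ₁ L :=
  fun ℓ h₁ h₂ h => (hF ℓ h₁ h₂ h).symm.le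

/-- Sub-conservation restricts to sub-ranges of levels. [folklore] -/
theorem SubconservesOn.mono {F : (ℓ : ℕ) → (Fin ℓ → Fin b) → ℝ} {ℓ₁ L ℓ₁' L' : ℕ} (hF : SubconservesOn F ℓ₁ L)
    (h₁ : ℓ₁ ≤ ℓ₁') (h₂ : L' ≤ L) : SubconservesOn F ℓ₁' L' :=
  fun ℓ hℓ hℓ' h => hF ℓ (h₁.trans hℓ) (lt_of_lt_of_le hℓ' h₂) h

/-- Re-indexing a sum over histories of length `ℓ + 1` as (history of length `ℓ`, last choice). [folklore] -/
theorem sum_histories_succ {ℓ : ℕ} (G : (Fin (ℓ + 1) → Fin b) → ℝ) :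
    ∑ g : Fin (ℓ + 1) → Fin b, G g = ∑ h : Fin ℓ → Fin b, ∑ c : Fin b, G (Fin.snoc h c) := by
  rw [← (Fin.snocEquiv fun _ : Fin (ℓ + 1) => Fin b).sum_comp, Fintype.sum_prod_type, Finset.sum_comm]
  rfl

/-- One conservation step: the level sum does not change from `ℓ` to `ℓ + 1`. [folklore] -/
theorem levelSum_succ {F : (ℓ : ℕ) → (Fin ℓ → Fin b) → ℝ} {ℓ₁ L ℓ : ℕ} (hF : ConservesOn F ℓ₁ L) (h₁ : ℓ₁ ≤ ℓ)
    (h₂ : ℓ < L) : levelSum F (ℓ + 1) = levelSum F ℓ := by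
  unfold levelSum
  rw [sum_histories_succ]
  exact sum_congr rfl fun h _ => (hF ℓ h₁ h₂ h).symm

/-- Conservation on `[ℓ₁, L)` ⇒ the level sums at `ℓ₁ + d ≤ L` and at `ℓ₁` agree. [folklore] -/
theorem levelSum_add {F : (ℓ : ℕ) → (Fin ℓ → Fin b) → ℝ} {ℓ₁ L : ℕ} (hF : ConservesOn F ℓ₁ L) :
    ∀ d : ℕ, ℓ₁ + d ≤ L → levelSum F (ℓ₁ + d) = levelSum F ℓ₁
  | 0, _ => rfl
  | d + 1, hd => by
    rw [← add_assoc, levelSum_succ hF (Nat.le_add_right _ _) (Nat.lt_of_succ_le hd)]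
    exact levelSum_add hF d (Nat.le_of_succ_le hd)

/-- **THE BACKWARD COLLAPSE.** Conservation on `[ℓ₁, L)` ⇒ `levelSum F L = levelSum F ℓ₁`: summing the masses of all
complete histories over the later choices collapses, level by level, to the total mass at level `ℓ₁`. [folklore] -/
theorem levelSum_eq_of_conservesOn {F : (ℓ : ℕ) → (Fin ℓ → Fin b) → ℝ} {ℓ₁ L : ℕ} (hF : ConservesOn F ℓ₁ L)
    (hL : ℓ₁ ≤ L) : levelSum F L = levelSum F ℓ₁ := by
  obtain ⟨d, rfl⟩ := Nat.exists_eq_add_of_le hL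
  exact levelSum_add hF d le_rfl

/-- In particular the total mass of the complete histories (the TERMS) is the root mass (the PARTITION FUNCTION of the
dressed scheme). [folklore] -/
theorem levelSum_eq_root {F : (ℓ : ℕ) → (Fin ℓ → Fin b) → ℝ} {L : ℕ} (hF : ConservesOn F 0 L) :
    levelSum F L = F 0 Fin.elim0 := by
  rw [levelSum_eq_of_conservesOn hF (Nat.zero_le L)]
  unfold levelSum
  rw [Fintype.sum_unique]
  exact congrArg (F 0) (Subsingleton.elim _ _)

/-- One sub-conservation step: the level sum does not increase from `ℓ` to `ℓ + 1`. [folklore] -/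
theorem levelSum_succ_le {F : (ℓ : ℕ) → (Fin ℓ → Fin b) → ℝ} {ℓ₁ L ℓ : ℕ} (hF : SubconservesOn F ℓ₁ L)
    (h₁ : ℓ₁ ≤ ℓ) (h₂ : ℓ < L) : levelSum F (ℓ + 1) ≤ levelSum F ℓ := by
  unfold levelSum
  rw [sum_histories_succ]
  exact sum_le_sum fun h _ => hF ℓ h₁ h₂ h

/-- Sub-conservation on `[ℓ₁, L)` ⇒ the level sum at `ℓ₁ + d ≤ L` is at most the one at `ℓ₁`. [folklore] -/
theorem levelSum_add_le {F : (ℓ : ℕ) → (Fin ℓ → Fin b) → ℝ} {ℓ₁ L : ℕ} (hF : SubconservesOn F ℓ₁ L) :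
    ∀ d : ℕ, ℓ₁ + d ≤ L → levelSum F (ℓ₁ + d) ≤ levelSum F ℓ₁
  | 0, _ => le_rfl
  | d + 1, hd => by
    rw [← add_assoc]
    exact (levelSum_succ_le hF (Nat.le_add_right _ _) (Nat.lt_of_succ_le hd)).trans
      (levelSum_add_le hF d (Nat.le_of_succ_le hd))

/-- **THE FORWARD DECAY.** Sub-conservation on `[ℓ₁, L)` ⇒ `levelSum F L ≤ levelSum F ℓ₁`. [folklore] -/
theorem levelSum_le_of_subconservesOn {F : (ℓ : ℕ) → (Fin ℓ → Fin b) → ℝ} {ℓ₁ L : ℕ} (hF : SubconservesOn F ℓ₁ L)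
    (hL : ℓ₁ ≤ L) : levelSum F L ≤ levelSum F ℓ₁ := by
  obtain ⟨d, rfl⟩ := Nat.exists_eq_add_of_le hL
  exact levelSum_add_le hF d le_rfl

/-- **THE SUB-TOWER BOUND.** A tower `M` conserving on `[ℓσ, L)` (the run's expansion from the slot's level on) and a
second tower `Msib` SUB-conserving on `[ℓσ + 1, L)` (the σ-MODIFIED expansion: the slot's factor — or the kernel that
regenerates it — replaced at level `ℓσ`, every later step mass-non-increasing) whose level-`(ℓσ+1)` masses are
dominated, history by history, by `s ×` the parent mass (the INSERTION inequality: the inserted factors total at most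
`s`) ⇒ the modified terms total at most `s ×` the terms: `levelSum Msib L ≤ s · levelSum M L`. No smallness
anywhere. [folklore] -/
theorem levelSum_le_of_insertion {M Msib : (ℓ : ℕ) → (Fin ℓ → Fin b) → ℝ} {ℓσ L : ℕ} {s : ℝ}
    (hM : ConservesOn M ℓσ L) (hMs : SubconservesOn Msib (ℓσ + 1) L) (hσ : ℓσ < L)
    (hins : ∀ h : Fin ℓσ → Fin b, ∑ c : Fin b, Msib (ℓσ + 1) (Fin.snoc h c) ≤ s * M ℓσ h) :
    levelSum Msib L ≤ s * levelSum M L := by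
  rw [levelSum_eq_of_conservesOn hM hσ.le]
  refine (levelSum_le_of_subconservesOn hMs (Nat.succ_le_of_lt hσ)).trans ?_
  unfold levelSum
  rw [sum_histories_succ, mul_sum]
  exact sum_le_sum fun h _ => hins h

end Tower

/-! ## §2 The generator: decompositions of unity propagated by stochastic kernels (the MODEL of the mechanism) -/

section Generator

variable {b : ℕ} {X : Type*} [Fintype X]

/-- THE DENSITIES OF THE MARKOV TOWER (MODEL).  A finite state space `X` (a cartoon of the field configurations of
the current level), an initial nonnegative density `m₀` (the dressed initial density), and for every level `ℓ` and
history `h`: DECOMPOSITION WEIGHTS `d ℓ h c : X → ℝ` (the factor inserted by choice `c` of the elementary decomposition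
of unity — a small-field function, its complement, or one piece of a multi-way decomposition; `Σ_c d ℓ h c x = 1`) and a
PROPAGATION KERNEL `P ℓ h c : X → X → ℝ` (the integral kernel of the next renormalization transformation and of the
per-term operation `R′`, which may depend on the whole history; rows summing to `1` = preservation of integrals).
The density of history `g` of length `ℓ + 1` at `y` is `Σ_x dens(init g)(x) · d(x) · P(x, y)` for the last choice of
`g`. [folklore] -/
def dens (m₀ : X → ℝ) (d : (ℓ : ℕ) → (Fin ℓ → Fin b) → Fin b → X → ℝ)
    (P : (ℓ : ℕ) → (Fin ℓ → Fin b) → Fin b → X → X → ℝ) : (ℓ : ℕ) → (Fin ℓ → Fin b) → X → ℝ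
  | 0, _ => m₀
  | ℓ + 1, g => fun y =>
    ∑ x, dens m₀ d P ℓ (Fin.init g) x * (d ℓ (Fin.init g) (g (Fin.last ℓ)) x * P ℓ (Fin.init g) (g (Fin.last ℓ)) x y)

/-- THE MASS of a history: the total of its density (its "integral"). The masses of the complete histories are the
TERM WEIGHTS `X K t τ`; the root mass is the partition function. [folklore] -/
def mass (m₀ : X → ℝ) (d : (ℓ : ℕ) → (Fin ℓ → Fin b) → Fin b → X → ℝ)
    (P : (ℓ : ℕ) → (Fin ℓ → Fin b) → Fin b → X → X → ℝ) (ℓ : ℕ) (h : Fin ℓ → Fin b) : ℝ :=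
  ∑ y, dens m₀ d P ℓ h y

variable {m₀ : X → ℝ} {d d' : (ℓ : ℕ) → (Fin ℓ → Fin b) → Fin b → X → ℝ}
  {P P' : (ℓ : ℕ) → (Fin ℓ → Fin b) → Fin b → X → X → ℝ}

/-- unfolding the density of a one-step extension. [folklore] -/
theorem dens_succ_snoc (ℓ : ℕ) (h : Fin ℓ → Fin b) (c : Fin b) (y : X) :
    dens m₀ d P (ℓ + 1) (Fin.snoc h c) y = ∑ x, dens m₀ d P ℓ h x * (d ℓ h c x * P ℓ h c x y) := by
  simp only [dens, Fin.init_snoc, Fin.snoc_last]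

/-- THE MASS OF AN EXTENSION in general: `Σ_x dens(x) · d_c(x) · (row sum of the kernel at x)`. [folklore] -/
theorem mass_succ_snoc_eq (ℓ : ℕ) (h : Fin ℓ → Fin b) (c : Fin b) :
    mass m₀ d P (ℓ + 1) (Fin.snoc h c) = ∑ x, dens m₀ d P ℓ h x * (d ℓ h c x * ∑ y, P ℓ h c x y) := by
  unfold mass
  simp_rw [dens_succ_snoc]
  rw [sum_comm]
  refine sum_congr rfl fun x _ => ?_
  rw [mul_sum, mul_sum]

/-- PROPAGATION PRESERVES MASS: with stochastic rows, the mass of the extension by `c` is `Σ_x dens(x) · d_c(x)`.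
[folklore] -/
theorem mass_succ_snoc {ℓ : ℕ} {h : Fin ℓ → Fin b} {c : Fin b} (hP : ∀ x, ∑ y, P ℓ h c x y = 1) :
    mass m₀ d P (ℓ + 1) (Fin.snoc h c) = ∑ x, dens m₀ d P ℓ h x * d ℓ h c x := by
  rw [mass_succ_snoc_eq]
  exact sum_congr rfl fun x _ => by rw [hP x, mul_one]

/-- **DECOMPOSITION OF UNITY + MASS-PRESERVING PROPAGATION ⇒ CONSERVATION** on every range of levels where the weights
sum to one and the kernels are stochastic. [folklore] -/
theorem conservesOn_mass {ℓ₁ L : ℕ} (hd : ∀ ℓ, ℓ₁ ≤ ℓ → ℓ < L → ∀ (h : Fin ℓ → Fin b) (x : X), ∑ c, d ℓ h c x = 1)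
    (hP : ∀ ℓ, ℓ₁ ≤ ℓ → ℓ < L → ∀ (h : Fin ℓ → Fin b) (c : Fin b) (x : X), ∑ y, P ℓ h c x y = 1) :
    ConservesOn (mass m₀ d P) ℓ₁ L := by
  intro ℓ h₁ h₂ h
  simp_rw [mass_succ_snoc (hP ℓ h₁ h₂ h _)]
  rw [sum_comm]
  unfold mass
  refine sum_congr rfl fun x _ => ?_
  rw [← mul_sum, hd ℓ h₁ h₂ h x, mul_one]

/-- Nonnegative data ⇒ nonnegative densities. [folklore] -/
theorem dens_nonneg (hm₀ : ∀ x, 0 ≤ m₀ x) (hd0 : ∀ ℓ (h : Fin ℓ → Fin b) c x, 0 ≤ d ℓ h c x)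
    (hP0 : ∀ ℓ (h : Fin ℓ → Fin b) c x y, 0 ≤ P ℓ h c x y) : ∀ (ℓ : ℕ) (h : Fin ℓ → Fin b) (y : X),
    0 ≤ dens m₀ d P ℓ h y
  | 0, _, y => hm₀ y
  | ℓ + 1, g, y => by
    simp only [dens]
    exact sum_nonneg fun x _ =>
      mul_nonneg (dens_nonneg hm₀ hd0 hP0 ℓ _ x) (mul_nonneg (hd0 _ _ _ _) (hP0 _ _ _ _ _))

/-- THE MODIFIED TOWER AGREES WITH THE ORIGINAL UP TO THE MODIFIED LEVEL: if the weights and kernels of `(d', P')`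
coincide with those of `(d, P)` at all levels `< ℓσ`, the densities coincide at all levels `≤ ℓσ`. [folklore] -/
theorem dens_eq_of_agree {ℓσ : ℕ} (hd : ∀ ℓ < ℓσ, d' ℓ = d ℓ) (hP : ∀ ℓ < ℓσ, P' ℓ = P ℓ) :
    ∀ ℓ ≤ ℓσ, dens m₀ d' P' ℓ = dens m₀ d P ℓ
  | 0, _ => rfl
  | ℓ + 1, hℓ => by
    funext g y
    simp only [dens, dens_eq_of_agree hd hP ℓ (Nat.le_of_succ_le hℓ), hd ℓ (Nat.lt_of_succ_le hℓ),
      hP ℓ (Nat.lt_of_succ_le hℓ)]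

/-- **THE ONE-LEVEL MODIFICATION INEQUALITY OF THE MODEL** (both mechanisms at once).  Modify the data at ONE level
`ℓσ` — new weights `d' ℓσ` and/or new kernels `P' ℓσ` — keeping everything below: if, pointwise in the parent
configuration, `Σ_c d'_c(x) · (row sum of P'_c at x) ≤ s`, then the level-`(ℓσ+1)` masses of the modified tower are
dominated by `s ×` the parent masses.  Needs only NONNEGATIVITY of the parent densities — no smallness. [folklore] -/
theorem modify_mass_le {ℓσ : ℕ} {s : ℝ} (hm₀ : ∀ x, 0 ≤ m₀ x) (hd0 : ∀ ℓ (h : Fin ℓ → Fin b) c x, 0 ≤ d ℓ h c x)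
    (hP0 : ∀ ℓ (h : Fin ℓ → Fin b) c x y, 0 ≤ P ℓ h c x y) (hd : ∀ ℓ < ℓσ, d' ℓ = d ℓ)
    (hP : ∀ ℓ < ℓσ, P' ℓ = P ℓ)
    (hins : ∀ (h : Fin ℓσ → Fin b) (x : X), ∑ c, d' ℓσ h c x * ∑ y, P' ℓσ h c x y ≤ s)
    (h : Fin ℓσ → Fin b) : ∑ c, mass m₀ d' P' (ℓσ + 1) (Fin.snoc h c) ≤ s * mass m₀ d P ℓσ h := by
  simp_rw [mass_succ_snoc_eq, dens_eq_of_agree hd hP ℓσ le_rfl]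
  rw [sum_comm]
  unfold mass
  rw [mul_sum]
  refine sum_le_sum fun x _ => ?_
  rw [← mul_sum, mul_comm s]
  exact mul_le_mul_of_nonneg_left (hins h x) (dens_nonneg hm₀ hd0 hP0 ℓσ h x)

/-- MECHANISM (A) — **INSERTION AT A DECOMPOSITION.** At the slot's level replace the decomposition weights by INSERTED
FACTORS `d' ℓσ h c` with `Σ_c d' ℓσ h c x ≤ s` (the shell indicators of the slot's polarities, each `≤ 1`: `s = 2` for
the two overlapping shells of rules R-η-1/R-η-2, `s = 1` per polarity), keep the (stochastic) kernels: the
level-`(ℓσ+1)` masses of the modified tower are dominated by `s ×` the parent masses. [folklore] -/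
theorem insertion_mass_le {ℓσ : ℕ} {s : ℝ} (hm₀ : ∀ x, 0 ≤ m₀ x) (hd0 : ∀ ℓ (h : Fin ℓ → Fin b) c x, 0 ≤ d ℓ h c x)
    (hP0 : ∀ ℓ (h : Fin ℓ → Fin b) c x y, 0 ≤ P ℓ h c x y) (hP : ∀ (h : Fin ℓσ → Fin b) (c : Fin b) (x : X),
      ∑ y, P ℓσ h c x y = 1)
    (hagree : ∀ ℓ < ℓσ, d' ℓ = d ℓ) (hins : ∀ (h : Fin ℓσ → Fin b) (x : X), ∑ c, d' ℓσ h c x ≤ s)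
    (h : Fin ℓσ → Fin b) : ∑ c, mass m₀ d' P (ℓσ + 1) (Fin.snoc h c) ≤ s * mass m₀ d P ℓσ h :=
  modify_mass_le hm₀ hd0 hP0 hagree (fun _ _ => rfl) (fun h x => by simp_rw [hP h _ x, mul_one]; exact hins h x) h

/-- MECHANISM (B) — **A MODIFIED KERNEL** (the occurrence of the slot's factor is REGENERATED by a normalising kernel —
the substituted small-field expression of an `ℝ`-operation — and the sibling replaces it INSIDE the kernel): keep the
decomposition of unity, replace the kernels at level `ℓσ` by `P'` with row sums `≤ r` (the RATIO of the
shell-modified to the unmodified normalising integral): the level-`(ℓσ+1)` masses of the modified tower are dominated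
by `r ×` the parent masses.  Here `r` is NOT structural — it is an estimate on the regenerating kernel (header §0(B)).
[folklore] -/
theorem kernelMod_mass_le {ℓσ : ℕ} {r : ℝ} (hm₀ : ∀ x, 0 ≤ m₀ x) (hd0 : ∀ ℓ (h : Fin ℓ → Fin b) c x, 0 ≤ d ℓ h c x)
    (hP0 : ∀ ℓ (h : Fin ℓ → Fin b) c x y, 0 ≤ P ℓ h c x y)
    (hd : ∀ (h : Fin ℓσ → Fin b) (x : X), ∑ c, d ℓσ h c x = 1) (hagree : ∀ ℓ < ℓσ, P' ℓ = P ℓ)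
    (hrow : ∀ (h : Fin ℓσ → Fin b) (c : Fin b) (x : X), ∑ y, P' ℓσ h c x y ≤ r) (h : Fin ℓσ → Fin b) :
    ∑ c, mass m₀ d P' (ℓσ + 1) (Fin.snoc h c) ≤ r * mass m₀ d P ℓσ h := by
  refine modify_mass_le hm₀ hd0 hP0 (fun _ _ => rfl) hagree (fun h x => ?_) h
  calc ∑ c, d ℓσ h c x * ∑ y, P' ℓσ h c x y ≤ ∑ c, d ℓσ h c x * r :=
      sum_le_sum fun c _ => mul_le_mul_of_nonneg_left (hrow h c x) (hd0 _ _ _ _)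
    _ = r := by rw [← sum_mul, hd h x, one_mul]

/-- **THE MODEL THEOREM.** Decompositions of unity and stochastic propagation at every level of the ORIGINAL tower,
nonnegative data; the MODIFIED tower `(d', P')` agrees with it at every level except `ℓσ < L`, where the one-level
modification inequality holds with constant `s` (mechanism (A), (B), or both) ⇒ the modified complete histories total
at most `s ×` the complete histories: `levelSum (mass m₀ d' P') L ≤ s · levelSum (mass m₀ d P) L`.  This is the
sibling sum of design (η) against the run's own partition function. [folklore] -/
theorem levelSum_mass_modify_le {ℓσ L : ℕ} {s : ℝ} (hm₀ : ∀ x, 0 ≤ m₀ x)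
    (hd0 : ∀ ℓ (h : Fin ℓ → Fin b) c x, 0 ≤ d ℓ h c x) (hP0 : ∀ ℓ (h : Fin ℓ → Fin b) c x y, 0 ≤ P ℓ h c x y)
    (hd : ∀ ℓ < L, ∀ (h : Fin ℓ → Fin b) (x : X), ∑ c, d ℓ h c x = 1)
    (hP : ∀ ℓ < L, ∀ (h : Fin ℓ → Fin b) (c : Fin b) (x : X), ∑ y, P ℓ h c x y = 1) (hσ : ℓσ < L)
    (hd' : ∀ ℓ < L, ℓ ≠ ℓσ → d' ℓ = d ℓ) (hP' : ∀ ℓ < L, ℓ ≠ ℓσ → P' ℓ = P ℓ)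
    (hins : ∀ (h : Fin ℓσ → Fin b) (x : X), ∑ c, d' ℓσ h c x * ∑ y, P' ℓσ h c x y ≤ s) :
    levelSum (mass m₀ d' P') L ≤ s * levelSum (mass m₀ d P) L := by
  have hb : ∀ ℓ < ℓσ, ℓ < L ∧ ℓ ≠ ℓσ := fun ℓ hℓ => ⟨hℓ.trans hσ, hℓ.ne⟩
  refine levelSum_le_of_insertion ((conservesOn_mass (fun ℓ _ hℓ => hd ℓ hℓ) fun ℓ _ hℓ => hP ℓ hℓ).mono
    (Nat.zero_le ℓσ) le_rfl) (ConservesOn.subconservesOn (conservesOn_mass ?_ ?_)) hσ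
    (modify_mass_le hm₀ hd0 hP0 (fun ℓ hℓ => hd' ℓ (hb ℓ hℓ).1 (hb ℓ hℓ).2)
      (fun ℓ hℓ => hP' ℓ (hb ℓ hℓ).1 (hb ℓ hℓ).2) hins)
  · intro ℓ h₁ h₂ h x
    rw [hd' ℓ h₂ (Nat.ne_of_gt (Nat.lt_of_succ_le h₁))]
    exact hd ℓ h₂ h x
  · intro ℓ h₁ h₂ h c x
    rw [hP' ℓ h₂ (Nat.ne_of_gt (Nat.lt_of_succ_le h₁))]
    exact hP ℓ h₂ h c x

/-- Mechanism (A) end to end: INSERTED FACTORS totalling `≤ s` at the slot's level, all kernels and all other weights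
unchanged ⇒ `levelSum (mass m₀ d' P) L ≤ s · levelSum (mass m₀ d P) L`. [folklore] -/
theorem levelSum_mass_insert_le {ℓσ L : ℕ} {s : ℝ} (hm₀ : ∀ x, 0 ≤ m₀ x)
    (hd0 : ∀ ℓ (h : Fin ℓ → Fin b) c x, 0 ≤ d ℓ h c x) (hP0 : ∀ ℓ (h : Fin ℓ → Fin b) c x y, 0 ≤ P ℓ h c x y)
    (hd : ∀ ℓ < L, ∀ (h : Fin ℓ → Fin b) (x : X), ∑ c, d ℓ h c x = 1)
    (hP : ∀ ℓ < L, ∀ (h : Fin ℓ → Fin b) (c : Fin b) (x : X), ∑ y, P ℓ h c x y = 1) (hσ : ℓσ < L)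
    (hd' : ∀ ℓ < L, ℓ ≠ ℓσ → d' ℓ = d ℓ) (hins : ∀ (h : Fin ℓσ → Fin b) (x : X), ∑ c, d' ℓσ h c x ≤ s) :
    levelSum (mass m₀ d' P) L ≤ s * levelSum (mass m₀ d P) L :=
  levelSum_mass_modify_le hm₀ hd0 hP0 hd hP hσ hd' (fun _ _ _ => rfl) fun h x => by
    simp_rw [hP ℓσ hσ h _ x, mul_one]; exact hins h x

/-- Mechanism (B) end to end: KERNELS at one level replaced by kernels with row sums `≤ r`, all weights and all other
kernels unchanged ⇒ `levelSum (mass m₀ d P') L ≤ r · levelSum (mass m₀ d P) L`. [folklore] -/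
theorem levelSum_mass_kernelMod_le {ℓσ L : ℕ} {r : ℝ} (hm₀ : ∀ x, 0 ≤ m₀ x)
    (hd0 : ∀ ℓ (h : Fin ℓ → Fin b) c x, 0 ≤ d ℓ h c x) (hP0 : ∀ ℓ (h : Fin ℓ → Fin b) c x y, 0 ≤ P ℓ h c x y)
    (hd : ∀ ℓ < L, ∀ (h : Fin ℓ → Fin b) (x : X), ∑ c, d ℓ h c x = 1)
    (hP : ∀ ℓ < L, ∀ (h : Fin ℓ → Fin b) (c : Fin b) (x : X), ∑ y, P ℓ h c x y = 1) (hσ : ℓσ < L)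
    (hP' : ∀ ℓ < L, ℓ ≠ ℓσ → P' ℓ = P ℓ)
    (hrow : ∀ (h : Fin ℓσ → Fin b) (c : Fin b) (x : X), ∑ y, P' ℓσ h c x y ≤ r) :
    levelSum (mass m₀ d P') L ≤ r * levelSum (mass m₀ d P) L :=
  levelSum_mass_modify_le hm₀ hd0 hP0 hd hP hσ (fun _ _ _ => rfl) hP' fun h x =>
    calc ∑ c, d ℓσ h c x * ∑ y, P' ℓσ h c x y ≤ ∑ c, d ℓσ h c x * r :=
        sum_le_sum fun c _ => mul_le_mul_of_nonneg_left (hrow h c x) (hd0 _ _ _ _)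
      _ = r := by rw [← sum_mul, hd ℓσ hσ h x, one_mul]

/-- The root mass of the model is the total initial mass, whatever the decompositions: `levelSum (mass m₀ d P) L =
Σ_x m₀ x` — the terms of the expansion sum to the partition function. [folklore] -/
theorem levelSum_mass_eq_total {L : ℕ} (hd : ∀ ℓ < L, ∀ (h : Fin ℓ → Fin b) (x : X), ∑ c, d ℓ h c x = 1)
    (hP : ∀ ℓ < L, ∀ (h : Fin ℓ → Fin b) (c : Fin b) (x : X), ∑ y, P ℓ h c x y = 1) :
    levelSum (mass m₀ d P) L = ∑ x, m₀ x :=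
  levelSum_eq_root (conservesOn_mass (fun ℓ _ hℓ => hd ℓ hℓ) fun ℓ _ hℓ => hP ℓ hℓ)

end Generator

/-! ## §3 The bridge: tower data ⇒ `SiblingSuppression`, and the (η) constructor's total at constant sibling factor -/

section Bridge

variable {ι : Type*} {l₀ : ℝ} {T : ℕ → Finset ι} {A B : ℕ → ℝ → ι → ℝ}

/-- THE TOWER-BOUND DATUM for one slot, one cutoff, one `t` — a PROOF FORMAT, not a strengthening (`towerBound_iff_le`:
it is logically equivalent to `Y ≤ s · Z`; its content is HOW the instantiating seat builds it, §0 of the header): a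
tower `M` conserving from the slot's level on whose complete histories total the term weights (`Z`), and a modified
tower `Msib`, sub-conserving above the slot's level, inserted there with total factor `≤ s`, whose complete histories
dominate the sibling weights (`≥ Y`).  NOT PRINTED as such — its ingredients are the printed decompositions of unity,
the integral preservation of the renormalization transformations and of `ℝ`/`ℝ′`, positivity, and the dressed scheme.
[folklore] -/
def TowerBound (s Z Y : ℝ) : Prop :=
  ∃ b L ℓσ : ℕ, ∃ M Msib : (ℓ : ℕ) → (Fin ℓ → Fin b) → ℝ,
    ℓσ < L ∧ ConservesOn M ℓσ L ∧ SubconservesOn Msib (ℓσ + 1) L ∧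
      (∀ h : Fin ℓσ → Fin b, ∑ c : Fin b, Msib (ℓσ + 1) (Fin.snoc h c) ≤ s * M ℓσ h) ∧
        Z = levelSum M L ∧ Y ≤ levelSum Msib L

/-- A tower-bound datum gives `Y ≤ s · Z` (`levelSum_le_of_insertion`). [folklore] -/
theorem le_of_towerBound {s Z Y : ℝ} (h : TowerBound s Z Y) : Y ≤ s * Z := by
  obtain ⟨b, L, ℓσ, M, Msib, hσ, hM, hMs, hins, hZ, hY⟩ := h
  rw [hZ]
  exact hY.trans (levelSum_le_of_insertion hM hMs hσ hins)

/-- HONESTY LEMMA: the datum is a FORMAT — `TowerBound s Z Y ↔ Y ≤ s · Z` (the one-level tower with a single choice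
realizes any such inequality).  What the format buys is the STRUCTURAL ROUTE to the inequality (§1–§2, §4): exhibit the
partial-history masses of the run's expansion and check one-step identities. [folklore] -/
theorem towerBound_iff_le {s Z Y : ℝ} : TowerBound s Z Y ↔ Y ≤ s * Z := by
  refine ⟨le_of_towerBound, fun hY => ⟨1, 1, 0, fun _ _ => Z, fun _ _ => Y, Nat.zero_lt_one, ?_, ?_, ?_, ?_, ?_⟩⟩
  · intro ℓ _ _ h
    simp
  · intro ℓ h₁ h₂
    omega
  · intro h
    simpa using hY
  · simp [levelSum]
  · simp [levelSum]

/-- The model of §2 IS a tower-bound datum (with `Y` the modified total exactly): original data `(m₀, d, P)` with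
decompositions of unity and stochastic kernels below `L`, modified data `(d', P')` differing only at level `ℓσ < L`
where the one-level modification inequality holds with constant `s`. [folklore] -/
theorem towerBound_of_generator {b : ℕ} {X : Type*} [Fintype X] {m₀ : X → ℝ}
    {d d' : (ℓ : ℕ) → (Fin ℓ → Fin b) → Fin b → X → ℝ} {P P' : (ℓ : ℕ) → (Fin ℓ → Fin b) → Fin b → X → X → ℝ}
    {ℓσ L : ℕ} {s : ℝ} (hm₀ : ∀ x, 0 ≤ m₀ x) (hd0 : ∀ ℓ (h : Fin ℓ → Fin b) c x, 0 ≤ d ℓ h c x)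
    (hP0 : ∀ ℓ (h : Fin ℓ → Fin b) c x y, 0 ≤ P ℓ h c x y)
    (hd : ∀ ℓ < L, ∀ (h : Fin ℓ → Fin b) (x : X), ∑ c, d ℓ h c x = 1)
    (hP : ∀ ℓ < L, ∀ (h : Fin ℓ → Fin b) (c : Fin b) (x : X), ∑ y, P ℓ h c x y = 1) (hσ : ℓσ < L)
    (hd' : ∀ ℓ < L, ℓ ≠ ℓσ → d' ℓ = d ℓ) (hP' : ∀ ℓ < L, ℓ ≠ ℓσ → P' ℓ = P ℓ)
    (hins : ∀ (h : Fin ℓσ → Fin b) (x : X), ∑ c, d' ℓσ h c x * ∑ y, P' ℓσ h c x y ≤ s) :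
    TowerBound s (levelSum (mass m₀ d P) L) (levelSum (mass m₀ d' P') L) :=
  towerBound_iff_le.2 (levelSum_mass_modify_le hm₀ hd0 hP0 hd hP hσ hd' hP' hins)

/-- **TOWER DATA ⇒ SIBLING SUPPRESSION.**  If for every slot `σ = ⟨a, i⟩` of the window, every cutoff `K` and every
`|t| ≤ l₀` the run's term weights and the slot's sibling weights admit a tower-bound datum with constant `S a`, then
`T4LipschitzCutoff.SiblingSuppression` holds with that `S` — uniformly in `K` and `t`. [folklore] -/
theorem siblingSuppression_of_towerBound' {X : ℕ → ℝ → ι → ℝ} {N : ℕ} {n : ℕ → ℕ}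
    {sibXs : (Σ _ : ℕ, ℕ) → ℕ → ℝ → ι → ℝ} {S : ℕ → ℝ}
    (h : ∀ σ ∈ (range (N + 1)).sigma (fun a => range (n a)), ∀ K t, |t| ≤ l₀ →
      TowerBound (S σ.1) (∑ τ ∈ T K, X K t τ) (∑ τ ∈ T K, sibXs σ K t τ)) :
    SiblingSuppression l₀ T X N n sibXs S :=
  fun σ hσ K t ht => le_of_towerBound (h σ hσ K t ht)

/-- **TOWER DATA ⇒ SIBLING SUPPRESSION WITH A CONSTANT** `S ≡ s` — no suppression exponent. [folklore] -/
theorem siblingSuppression_of_towerBound {X : ℕ → ℝ → ι → ℝ} {N : ℕ} {n : ℕ → ℕ}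
    {sibXs : (Σ _ : ℕ, ℕ) → ℕ → ℝ → ι → ℝ} {s : ℝ}
    (h : ∀ σ ∈ (range (N + 1)).sigma (fun a => range (n a)), ∀ K t, |t| ≤ l₀ →
      TowerBound s (∑ τ ∈ T K, X K t τ) (∑ τ ∈ T K, sibXs σ K t τ)) :
    SiblingSuppression l₀ T X N n sibXs (fun _ => s) :=
  siblingSuppression_of_towerBound' h

/-- **ADDITIVITY OVER OCCURRENCE CLASSES.**  If the sibling weights split (up to `≤`) into two families — e.g. the
occurrences at DECOMPOSITIONS (mechanism (A), structural constant) and the occurrences REGENERATED BY KERNELS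
(mechanism (B), ratio estimate) — each satisfying `SiblingSuppression` with its own `S`, then the whole satisfies it
with the sum. [folklore] -/
theorem siblingSuppression_add {X : ℕ → ℝ → ι → ℝ} {N : ℕ} {n : ℕ → ℕ}
    {sibXs sib₁ sib₂ : (Σ _ : ℕ, ℕ) → ℕ → ℝ → ι → ℝ} {S₁ S₂ : ℕ → ℝ}
    (h₁ : SiblingSuppression l₀ T X N n sib₁ S₁) (h₂ : SiblingSuppression l₀ T X N n sib₂ S₂)
    (hle : ∀ σ ∈ (range (N + 1)).sigma (fun a => range (n a)), ∀ K t, |t| ≤ l₀ →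
      ∑ τ ∈ T K, sibXs σ K t τ ≤ ∑ τ ∈ T K, sib₁ σ K t τ + ∑ τ ∈ T K, sib₂ σ K t τ) :
    SiblingSuppression l₀ T X N n sibXs (fun a => S₁ a + S₂ a) := fun σ hσ K t ht => by
  refine (hle σ hσ K t ht).trans ?_
  show _ ≤ (S₁ σ.1 + S₂ σ.1) * _
  rw [add_mul]
  exact add_le_add (h₁ σ hσ K t ht) (h₂ σ hσ K t ht)

/-- **THE (η) CONSTRUCTOR AT CONSTANT SIBLING FACTOR.**  Two Lipschitz slot ledgers, tower data for both runs with
constant `s ≥ 0`, a nonnegative SUMMABLE two-run width `ρ` and the union bounds ⇒ the literal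
`T4IndicatorShell.ShellWeightBound` with band weight `K ↦ Σ_{a ≤ N} n_a · lipWeight L (fun _ ↦ s) ρ a K` —
`T4LipschitzCutoff.shellWeightBound_of_lipProfile` with both `SiblingSuppression` binders DISCHARGED by
`siblingSuppression_of_towerBound`. [folklore] -/
theorem shellWeightBound_of_towerBound {N : ℕ} {n : ℕ → ℕ}
    {shAs sibAs shBs sibBs : (Σ _ : ℕ, ℕ) → ℕ → ℝ → ι → ℝ} {Lχ ρ : ℕ → ℝ} {s : ℝ} {shA shB : ℕ → ℝ → ι → ℝ}
    (hLA : LipSlotLedger l₀ T A N n shAs sibAs Lχ ρ) (hLB : LipSlotLedger l₀ T B N n shBs sibBs Lχ ρ)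
    (hTA : ∀ σ ∈ (range (N + 1)).sigma (fun a => range (n a)), ∀ K t, |t| ≤ l₀ →
      TowerBound s (∑ τ ∈ T K, A K t τ) (∑ τ ∈ T K, sibAs σ K t τ))
    (hTB : ∀ σ ∈ (range (N + 1)).sigma (fun a => range (n a)), ∀ K t, |t| ≤ l₀ →
      TowerBound s (∑ τ ∈ T K, B K t τ) (∑ τ ∈ T K, sibBs σ K t τ))
    (hL : ∀ a ≤ N, 0 ≤ Lχ a) (hs : 0 ≤ s) (hρ0 : ∀ j, 0 ≤ ρ j) (hρ : Summable ρ)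
    (hA0 : ∀ K t, |t| ≤ l₀ → ∀ τ ∈ T K, 0 ≤ shA K t τ) (hAle : ∀ K t, |t| ≤ l₀ → ∀ τ ∈ T K, shA K t τ ≤ A K t τ)
    (hAu : ∀ K t, |t| ≤ l₀ → ∀ τ ∈ T K,
      shA K t τ ≤ ∑ σ ∈ (range (N + 1)).sigma (fun a => range (n a)), shAs σ K t τ)
    (hB0 : ∀ K t, |t| ≤ l₀ → ∀ τ ∈ T K, 0 ≤ shB K t τ) (hBle : ∀ K t, |t| ≤ l₀ → ∀ τ ∈ T K, shB K t τ ≤ B K t τ)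
    (hBu : ∀ K t, |t| ≤ l₀ → ∀ τ ∈ T K,
      shB K t τ ≤ ∑ σ ∈ (range (N + 1)).sigma (fun a => range (n a)), shBs σ K t τ) :
    ShellWeightBound l₀ T A B shA shB
      (fun K => ∑ a ∈ range (N + 1), (n a : ℝ) * lipWeight Lχ (fun _ => s) ρ a K) :=
  shellWeightBound_of_lipProfile hLA hLB (siblingSuppression_of_towerBound hTA)
    (siblingSuppression_of_towerBound hTB) hL (fun _ _ => hs) hρ0 hρ hA0 hAle hAu hB0 hBle hBu

/-- **THE TOTAL AT CONSTANT SIBLING FACTOR:** `Σ_K Wsh_K = s · C₀(n, L) · Σ_j ρ_j` — cube count × Lipschitz constant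
summed over the window once, times the constant `s`, times the total two-run width.  NO suppression exponent, NO
`T4ShellCount.LevelGain`: at constant sibling factor the summability of the shell weights is the summability of `ρ`
(node U1b / U4′) and nothing else. [folklore] -/
theorem tsum_weight_const {N : ℕ} (n : ℕ → ℕ) (Lχ : ℕ → ℝ) (s : ℝ) {ρ : ℕ → ℝ} (hρ : Summable ρ) :
    ∑' K, (∑ a ∈ range (N + 1), (n a : ℝ) * lipWeight Lχ (fun _ => s) ρ a K)
      = s * C0 N (fun a => (n a : ℝ)) Lχ * ∑' j, ρ j := by
  rw [tsum_weight_eq n Lχ (fun _ => s) hρ]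
  congr 1
  unfold C0
  rw [mul_sum]
  exact sum_congr rfl fun a _ => by ring

/-- The band weight at constant sibling factor is summable (from `Summable ρ` alone). [folklore] -/
theorem summable_weight_const {N : ℕ} (n : ℕ → ℕ) (Lχ : ℕ → ℝ) (s : ℝ) {ρ : ℕ → ℝ} (hρ : Summable ρ) :
    Summable fun K => ∑ a ∈ range (N + 1), (n a : ℝ) * lipWeight Lχ (fun _ => s) ρ a K :=
  summable_sum fun a _ => (summable_lipWeight hρ a).mul_left _

/-- With the printed cube count the constant is at most `s · V · Σ_{a ≤ N} Λ^a L(a)`: window entropy × Lipschitz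
constants × the structural factor `s` — and NO `e^{−p₀}`. [folklore] -/
theorem tsum_weight_const_le_of_cubeCount {N : ℕ} {n : ℕ → ℕ} {V Λ : ℝ} {Lχ ρ : ℕ → ℝ} {s : ℝ}
    (hc : CubeCount N n V Λ) (hL : ∀ a ≤ N, 0 ≤ Lχ a) (hs : 0 ≤ s) (hρ0 : ∀ j, 0 ≤ ρ j) (hρ : Summable ρ) :
    ∑' K, (∑ a ∈ range (N + 1), (n a : ℝ) * lipWeight Lχ (fun _ => s) ρ a K)
      ≤ s * (V * ∑ a ∈ range (N + 1), Λ ^ a * Lχ a) * ∑' j, ρ j := by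
  rw [tsum_weight_const n Lχ s hρ, mul_assoc, mul_assoc]
  refine mul_le_mul_of_nonneg_left ?_ hs
  exact mul_le_mul_of_nonneg_right (C0_le_of_cubeCount' hc hL) (tsum_nonneg hρ0)

end Bridge

/-! ## §4 The integral tower: the same bookkeeping with Bochner integrals (the shape the instantiating seat meets) -/

section IntegralTower

open MeasureTheory

variable {b : ℕ}

/-- DECOMPOSITION OF UNITY UNDER THE INTEGRAL: factors `φ_c` with `Σ_c φ_c ≡ 1` split `∫ g` exactly. [folklore] -/
theorem sum_integral_mul_eq_of_unity {Ω₀ : Type*} [MeasurableSpace Ω₀] {ν : Measure Ω₀} (φ : Fin b → Ω₀ → ℝ)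
    (g : Ω₀ → ℝ) (hφ : ∀ ω, ∑ c, φ c ω = 1) (hint : ∀ c, Integrable (fun ω => φ c ω * g ω) ν) :
    ∑ c, ∫ ω, φ c ω * g ω ∂ν = ∫ ω, g ω ∂ν := by
  rw [← integral_finsetSum _ fun c _ => hint c]
  refine integral_congr_ae (ae_of_all _ fun ω => ?_)
  show ∑ c, φ c ω * g ω = g ω
  rw [← sum_mul, hφ ω, one_mul]

/-- INSERTED FACTORS UNDER THE INTEGRAL: `Σ_c ψ_c ≤ s` pointwise and `g ≥ 0` ⇒ `Σ_c ∫ ψ_c g ≤ s ∫ g`. [folklore] -/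
theorem sum_integral_mul_le_of_le {Ω₀ : Type*} [MeasurableSpace Ω₀] {ν : Measure Ω₀} {s : ℝ} (ψ : Fin b → Ω₀ → ℝ)
    (g : Ω₀ → ℝ) (hg : ∀ ω, 0 ≤ g ω) (hψ : ∀ ω, ∑ c, ψ c ω ≤ s)
    (hint : ∀ c, Integrable (fun ω => ψ c ω * g ω) ν) (hgi : Integrable g ν) :
    ∑ c, ∫ ω, ψ c ω * g ω ∂ν ≤ s * ∫ ω, g ω ∂ν := by
  rw [← integral_finsetSum _ fun c _ => hint c, ← integral_const_mul]
  refine integral_mono (integrable_finsetSum _ fun c _ => hint c) (hgi.const_mul s) fun ω => ?_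
  show ∑ c, ψ c ω * g ω ≤ s * g ω
  rw [← sum_mul]
  exact mul_le_mul_of_nonneg_right (hψ ω) (hg ω)

variable {Ω : ℕ → Type*} [∀ ℓ, MeasurableSpace (Ω ℓ)] {μ : (ℓ : ℕ) → Measure (Ω ℓ)}
  {ρ ρ' : (ℓ : ℕ) → (Fin ℓ → Fin b) → Ω ℓ → ℝ} {φ : (ℓ : ℕ) → (Fin ℓ → Fin b) → Fin b → Ω ℓ → ℝ}

/-- **THE INTEGRAL TOWER CONSERVES.**  Level spaces `(Ω ℓ, μ ℓ)` (the configurations alive after `ℓ` elementary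
operations), partial-term integrands `ρ ℓ h`, and at every level of the range an elementary DECOMPOSITION OF UNITY
`φ ℓ h c` (`Σ_c ≡ 1`; a non-branching operation is the trivial decomposition) followed by an INTEGRAL-PRESERVING
operation — packaged as the one-step identity `∫ ρ(ℓ+1)(h,c) dμ(ℓ+1) = ∫ φ_c · ρ ℓ h dμ ℓ` (what `T` (B14 (0.1)),
`ℝ` (B15 (0.3)–(0.4)) and the identity rewrites give, header §0) ⇒ the masses `∫ ρ ℓ h dμ ℓ` form a conserving tower.
[folklore] -/
theorem conservesOn_integral {ℓ₁ L : ℕ}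
    (hunity : ∀ ℓ, ℓ₁ ≤ ℓ → ℓ < L → ∀ (h : Fin ℓ → Fin b) (ω : Ω ℓ), ∑ c, φ ℓ h c ω = 1)
    (hstep : ∀ ℓ, ℓ₁ ≤ ℓ → ℓ < L → ∀ (h : Fin ℓ → Fin b) (c : Fin b),
      ∫ ω, ρ (ℓ + 1) (Fin.snoc h c) ω ∂μ (ℓ + 1) = ∫ ω, φ ℓ h c ω * ρ ℓ h ω ∂μ ℓ)
    (hint : ∀ ℓ, ℓ₁ ≤ ℓ → ℓ < L → ∀ (h : Fin ℓ → Fin b) (c : Fin b),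
      Integrable (fun ω => φ ℓ h c ω * ρ ℓ h ω) (μ ℓ)) :
    ConservesOn (fun ℓ h => ∫ ω, ρ ℓ h ω ∂μ ℓ) ℓ₁ L := by
  intro ℓ h₁ h₂ h
  show ∫ ω, ρ ℓ h ω ∂μ ℓ = ∑ c, ∫ ω, ρ (ℓ + 1) (Fin.snoc h c) ω ∂μ (ℓ + 1)
  simp_rw [hstep ℓ h₁ h₂ h]
  exact (sum_integral_mul_eq_of_unity (φ ℓ h) (ρ ℓ h) (hunity ℓ h₁ h₂ h) (hint ℓ h₁ h₂ h)).symm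

/-- **THE MODIFIED INTEGRAL TOWER SUB-CONSERVES** when every later step satisfies the one-step identity as an
INEQUALITY `∫ ρ'(ℓ+1)(h,c) ≤ ∫ φ_c · ρ' ℓ h` (integral-preserving or integral-decreasing operations on the modified
family). [folklore] -/
theorem subconservesOn_integral {ℓ₁ L : ℕ}
    (hunity : ∀ ℓ, ℓ₁ ≤ ℓ → ℓ < L → ∀ (h : Fin ℓ → Fin b) (ω : Ω ℓ), ∑ c, φ ℓ h c ω = 1)
    (hstep : ∀ ℓ, ℓ₁ ≤ ℓ → ℓ < L → ∀ (h : Fin ℓ → Fin b) (c : Fin b),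
      ∫ ω, ρ' (ℓ + 1) (Fin.snoc h c) ω ∂μ (ℓ + 1) ≤ ∫ ω, φ ℓ h c ω * ρ' ℓ h ω ∂μ ℓ)
    (hint : ∀ ℓ, ℓ₁ ≤ ℓ → ℓ < L → ∀ (h : Fin ℓ → Fin b) (c : Fin b),
      Integrable (fun ω => φ ℓ h c ω * ρ' ℓ h ω) (μ ℓ)) :
    SubconservesOn (fun ℓ h => ∫ ω, ρ' ℓ h ω ∂μ ℓ) ℓ₁ L := by
  intro ℓ h₁ h₂ h
  show ∑ c, ∫ ω, ρ' (ℓ + 1) (Fin.snoc h c) ω ∂μ (ℓ + 1) ≤ ∫ ω, ρ' ℓ h ω ∂μ ℓ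
  rw [← sum_integral_mul_eq_of_unity (φ ℓ h) (ρ' ℓ h) (hunity ℓ h₁ h₂ h) (hint ℓ h₁ h₂ h)]
  exact sum_le_sum fun c _ => hstep ℓ h₁ h₂ h c

/-- **INTEGRAL TOWER ⇒ TOWER BOUND.**  The run's partial integrands `ρ` (decompositions of unity + integral-preserving
steps on `[ℓσ, L)`), the σ-modified integrands `ρ'` (integral-non-increasing steps on `(ℓσ, L)`), and AT THE SLOT'S
LEVEL the modification inequality `∫ ρ'(ℓσ+1)(h,c) ≤ ∫ ψ_{h,c} · ρ ℓσ h` with NONNEGATIVE parents and `Σ_c ψ_{h,c} ≤ s`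
pointwise (mechanism (A): `ψ_c` = the shell indicator of polarity `c`, `s = 2`; mechanism (B): `ψ_c = φ_c ·`(row sum of
the modified kernel) `≤ φ_c · r`, `s = r`) ⇒ `TowerBound s (levelSum ∫ρ L) (levelSum ∫ρ' L)`. [folklore] -/
theorem towerBound_of_integralTower {ℓσ L : ℕ} {s : ℝ} {ψ : (Fin ℓσ → Fin b) → Fin b → Ω ℓσ → ℝ} (hσ : ℓσ < L)
    (hunity : ∀ ℓ, ℓσ ≤ ℓ → ℓ < L → ∀ (h : Fin ℓ → Fin b) (ω : Ω ℓ), ∑ c, φ ℓ h c ω = 1)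
    (hstep : ∀ ℓ, ℓσ ≤ ℓ → ℓ < L → ∀ (h : Fin ℓ → Fin b) (c : Fin b),
      ∫ ω, ρ (ℓ + 1) (Fin.snoc h c) ω ∂μ (ℓ + 1) = ∫ ω, φ ℓ h c ω * ρ ℓ h ω ∂μ ℓ)
    (hint : ∀ ℓ, ℓσ ≤ ℓ → ℓ < L → ∀ (h : Fin ℓ → Fin b) (c : Fin b),
      Integrable (fun ω => φ ℓ h c ω * ρ ℓ h ω) (μ ℓ))
    (hstep' : ∀ ℓ, ℓσ + 1 ≤ ℓ → ℓ < L → ∀ (h : Fin ℓ → Fin b) (c : Fin b),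
      ∫ ω, ρ' (ℓ + 1) (Fin.snoc h c) ω ∂μ (ℓ + 1) ≤ ∫ ω, φ ℓ h c ω * ρ' ℓ h ω ∂μ ℓ)
    (hint' : ∀ ℓ, ℓσ + 1 ≤ ℓ → ℓ < L → ∀ (h : Fin ℓ → Fin b) (c : Fin b),
      Integrable (fun ω => φ ℓ h c ω * ρ' ℓ h ω) (μ ℓ))
    (hins : ∀ (h : Fin ℓσ → Fin b) (c : Fin b),
      ∫ ω, ρ' (ℓσ + 1) (Fin.snoc h c) ω ∂μ (ℓσ + 1) ≤ ∫ ω, ψ h c ω * ρ ℓσ h ω ∂μ ℓσ)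
    (hψ : ∀ (h : Fin ℓσ → Fin b) (ω : Ω ℓσ), ∑ c, ψ h c ω ≤ s)
    (hψint : ∀ (h : Fin ℓσ → Fin b) (c : Fin b), Integrable (fun ω => ψ h c ω * ρ ℓσ h ω) (μ ℓσ))
    (hρ0 : ∀ (h : Fin ℓσ → Fin b) (ω : Ω ℓσ), 0 ≤ ρ ℓσ h ω)
    (hρint : ∀ h : Fin ℓσ → Fin b, Integrable (ρ ℓσ h) (μ ℓσ)) :
    TowerBound s (levelSum (fun ℓ h => ∫ ω, ρ ℓ h ω ∂μ ℓ) L) (levelSum (fun ℓ h => ∫ ω, ρ' ℓ h ω ∂μ ℓ) L) :=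
  ⟨b, L, ℓσ, fun ℓ h => ∫ ω, ρ ℓ h ω ∂μ ℓ, fun ℓ h => ∫ ω, ρ' ℓ h ω ∂μ ℓ, hσ,
    conservesOn_integral hunity hstep hint,
    subconservesOn_integral (fun ℓ h₁ h₂ => hunity ℓ (Nat.le_of_succ_le h₁) h₂) hstep' hint',
    fun h => (sum_le_sum fun c _ => hins h c).trans
      (sum_integral_mul_le_of_le (ψ h) (ρ ℓσ h) (hρ0 h) (hψ h) (hψint h) (hρint h)),
    rfl, le_rfl⟩

/-- The root identity of the integral tower: conservation from level `0` ⇒ the complete partial terms integrate, in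
total, to the initial (dressed) mass `∫ ρ 0 dμ 0` — the partition function of the dressed scheme. [folklore] -/
theorem levelSum_integral_eq_root {L : ℕ}
    (hunity : ∀ ℓ < L, ∀ (h : Fin ℓ → Fin b) (ω : Ω ℓ), ∑ c, φ ℓ h c ω = 1)
    (hstep : ∀ ℓ < L, ∀ (h : Fin ℓ → Fin b) (c : Fin b),
      ∫ ω, ρ (ℓ + 1) (Fin.snoc h c) ω ∂μ (ℓ + 1) = ∫ ω, φ ℓ h c ω * ρ ℓ h ω ∂μ ℓ)
    (hint : ∀ ℓ < L, ∀ (h : Fin ℓ → Fin b) (c : Fin b), Integrable (fun ω => φ ℓ h c ω * ρ ℓ h ω) (μ ℓ)) :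
    levelSum (fun ℓ h => ∫ ω, ρ ℓ h ω ∂μ ℓ) L = ∫ ω, ρ 0 Fin.elim0 ω ∂μ 0 :=
  levelSum_eq_root (conservesOn_integral (fun ℓ _ hℓ => hunity ℓ hℓ) (fun ℓ _ hℓ => hstep ℓ hℓ)
    fun ℓ _ hℓ => hint ℓ hℓ)

end IntegralTower

/-! ## §5 [v1.1] The a.e. forms of the integral tower, and the STOPPED insertion (history-dependent insertion level)

Appended for the cross-read of v1 (`t4/T4-XREAD-SiblingInsertion-v1.md`, t4-ne7-p2 gen 4; GAPS C-ne7p2-6 / D-ne7p2-6a);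
§1–§4 above are v1 byte for byte.  All [folklore].
(D-1) A.E. FORMS.  The instantiating seat's remainders are nonnegative only `μ`-ALMOST EVERYWHERE
(`T4LipschitzLedger.TermRepr.rem_nonneg : … → 0 ≤ᵐ[μ K τ] RX K t τ`), and its decompositions of unity and inserted shells
need only be checked `μ ℓ`-a.e. on the level spaces: `sum_integral_mul_eq_of_unity_ae`, `sum_integral_mul_le_of_le_ae`,
`conservesOn_integral_ae`, `subconservesOn_integral_ae`, `towerBound_of_integralTower_ae` (§4's everywhere forms are the
special case `ae_of_all`; same proofs with `integral_congr_ae` / `integral_mono_ae`).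
(M-1) THE STOPPED INSERTION.  Print introduces each decomposition of unity «in each component of Z separately» (B15
p. 181 [render `1989-cmp122-large-field-I-p007`]) and `ℝ` acts history by history, so the tower level at which THE SLOT'S
factor enters may depend on the history.  §3–§4 insert at ONE level `ℓσ` for all histories (the seat then fixes a
history-independent SCHEDULE, header §0).  `levelSum_le_of_stoppedInsertion` removes the fixed level: every node `(ℓ, h)`
of the tower carries a status `W ℓ h`, WAITING (`true`: on this partial history the slot's factor is not yet inserted;
there the run's masses `M` conserve) or ACTIVE (`false`: inserted at or above this node; there the modified masses `Msib`
sub-conserve); roots wait; the children of a waiting node are either all waiting (pass-through) or all active (THE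
INSERTION, with `Σ_c Msib child ≤ s · M parent`); the children of an active node are active; a leaf still waiting
satisfies `Msib ≤ s · M` (for the sibling family: `Msib = 0` there and `0 ≤ s · M` by positivity).  Conclusion
`levelSum Msib L ≤ s · levelSum M L`: the potential `Φ = bif waiting then s · M else Msib` is a sub-conserving tower with root
value `s · levelSum M ℓ₁` (proof: three one-step cases).  v1's `levelSum_le_of_insertion` is the schedule "waiting iff
`ℓ ≤ ℓσ`" (`levelSum_le_of_insertion_of_stopped`, consistency).  `towerBound_of_stoppedInsertion` /
`towerBound_of_stoppedIntegralTower` hand the stopped form to the seat in the `TowerBound` format of §3 (so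
`siblingSuppression_of_towerBound` / `shellWeightBound_of_towerBound` apply verbatim). -/

section IntegralTowerAE

open MeasureTheory

variable {b : ℕ}

/-- DECOMPOSITION OF UNITY UNDER THE INTEGRAL, a.e. form: `Σ_c φ_c = 1` `ν`-a.e. splits `∫ g` exactly. [folklore] -/
theorem sum_integral_mul_eq_of_unity_ae {Ω₀ : Type*} [MeasurableSpace Ω₀] {ν : Measure Ω₀} (φ : Fin b → Ω₀ → ℝ)
    (g : Ω₀ → ℝ) (hφ : ∀ᵐ ω ∂ν, ∑ c, φ c ω = 1) (hint : ∀ c, Integrable (fun ω => φ c ω * g ω) ν) :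
    ∑ c, ∫ ω, φ c ω * g ω ∂ν = ∫ ω, g ω ∂ν := by
  rw [← integral_finsetSum _ fun c _ => hint c]
  refine integral_congr_ae (hφ.mono fun ω hω => ?_)
  show ∑ c, φ c ω * g ω = g ω
  rw [← sum_mul, hω, one_mul]

/-- INSERTED FACTORS UNDER THE INTEGRAL, a.e. form: `Σ_c ψ_c ≤ s` and `g ≥ 0` `ν`-a.e. ⇒ `Σ_c ∫ ψ_c g ≤ s ∫ g`.
[folklore] -/
theorem sum_integral_mul_le_of_le_ae {Ω₀ : Type*} [MeasurableSpace Ω₀] {ν : Measure Ω₀} {s : ℝ} (ψ : Fin b → Ω₀ → ℝ)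
    (g : Ω₀ → ℝ) (hg : 0 ≤ᵐ[ν] g) (hψ : ∀ᵐ ω ∂ν, ∑ c, ψ c ω ≤ s)
    (hint : ∀ c, Integrable (fun ω => ψ c ω * g ω) ν) (hgi : Integrable g ν) :
    ∑ c, ∫ ω, ψ c ω * g ω ∂ν ≤ s * ∫ ω, g ω ∂ν := by
  rw [← integral_finsetSum _ fun c _ => hint c, ← integral_const_mul]
  refine integral_mono_ae (integrable_finsetSum _ fun c _ => hint c) (hgi.const_mul s) ?_
  filter_upwards [hg, hψ] with ω hgω hψω
  show ∑ c, ψ c ω * g ω ≤ s * g ω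
  rw [← sum_mul]
  exact mul_le_mul_of_nonneg_right hψω hgω

variable {Ω : ℕ → Type*} [∀ ℓ, MeasurableSpace (Ω ℓ)] {μ : (ℓ : ℕ) → Measure (Ω ℓ)}
  {ρ ρ' : (ℓ : ℕ) → (Fin ℓ → Fin b) → Ω ℓ → ℝ} {φ : (ℓ : ℕ) → (Fin ℓ → Fin b) → Fin b → Ω ℓ → ℝ}

/-- **THE INTEGRAL TOWER CONSERVES**, a.e. form of `conservesOn_integral`: unity of the elementary decomposition
`Σ_c φ ℓ h c = 1` is required only `μ ℓ`-a.e. [folklore] -/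
theorem conservesOn_integral_ae {ℓ₁ L : ℕ}
    (hunity : ∀ ℓ, ℓ₁ ≤ ℓ → ℓ < L → ∀ h : Fin ℓ → Fin b, ∀ᵐ ω ∂μ ℓ, ∑ c, φ ℓ h c ω = 1)
    (hstep : ∀ ℓ, ℓ₁ ≤ ℓ → ℓ < L → ∀ (h : Fin ℓ → Fin b) (c : Fin b),
      ∫ ω, ρ (ℓ + 1) (Fin.snoc h c) ω ∂μ (ℓ + 1) = ∫ ω, φ ℓ h c ω * ρ ℓ h ω ∂μ ℓ)
    (hint : ∀ ℓ, ℓ₁ ≤ ℓ → ℓ < L → ∀ (h : Fin ℓ → Fin b) (c : Fin b),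
      Integrable (fun ω => φ ℓ h c ω * ρ ℓ h ω) (μ ℓ)) :
    ConservesOn (fun ℓ h => ∫ ω, ρ ℓ h ω ∂μ ℓ) ℓ₁ L := by
  intro ℓ h₁ h₂ h
  show ∫ ω, ρ ℓ h ω ∂μ ℓ = ∑ c, ∫ ω, ρ (ℓ + 1) (Fin.snoc h c) ω ∂μ (ℓ + 1)
  simp_rw [hstep ℓ h₁ h₂ h]
  exact (sum_integral_mul_eq_of_unity_ae (φ ℓ h) (ρ ℓ h) (hunity ℓ h₁ h₂ h) (hint ℓ h₁ h₂ h)).symm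

/-- **THE MODIFIED INTEGRAL TOWER SUB-CONSERVES**, a.e. form of `subconservesOn_integral`. [folklore] -/
theorem subconservesOn_integral_ae {ℓ₁ L : ℕ}
    (hunity : ∀ ℓ, ℓ₁ ≤ ℓ → ℓ < L → ∀ h : Fin ℓ → Fin b, ∀ᵐ ω ∂μ ℓ, ∑ c, φ ℓ h c ω = 1)
    (hstep : ∀ ℓ, ℓ₁ ≤ ℓ → ℓ < L → ∀ (h : Fin ℓ → Fin b) (c : Fin b),
      ∫ ω, ρ' (ℓ + 1) (Fin.snoc h c) ω ∂μ (ℓ + 1) ≤ ∫ ω, φ ℓ h c ω * ρ' ℓ h ω ∂μ ℓ)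
    (hint : ∀ ℓ, ℓ₁ ≤ ℓ → ℓ < L → ∀ (h : Fin ℓ → Fin b) (c : Fin b),
      Integrable (fun ω => φ ℓ h c ω * ρ' ℓ h ω) (μ ℓ)) :
    SubconservesOn (fun ℓ h => ∫ ω, ρ' ℓ h ω ∂μ ℓ) ℓ₁ L := by
  intro ℓ h₁ h₂ h
  show ∑ c, ∫ ω, ρ' (ℓ + 1) (Fin.snoc h c) ω ∂μ (ℓ + 1) ≤ ∫ ω, ρ' ℓ h ω ∂μ ℓ
  rw [← sum_integral_mul_eq_of_unity_ae (φ ℓ h) (ρ' ℓ h) (hunity ℓ h₁ h₂ h) (hint ℓ h₁ h₂ h)]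
  exact sum_le_sum fun c _ => hstep ℓ h₁ h₂ h c

/-- **INTEGRAL TOWER ⇒ TOWER BOUND**, a.e. form of `towerBound_of_integralTower`: unity of the decompositions, the
insertion inequality `Σ_c ψ_{h,c} ≤ s` and the nonnegativity of the parents `ρ ℓσ h` are required only `μ ℓ`-a.e.
(this is the form met by `T4LipschitzLedger.TermRepr`, whose `rem_nonneg` is an a.e. statement). [folklore] -/
theorem towerBound_of_integralTower_ae {ℓσ L : ℕ} {s : ℝ} {ψ : (Fin ℓσ → Fin b) → Fin b → Ω ℓσ → ℝ} (hσ : ℓσ < L)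
    (hunity : ∀ ℓ, ℓσ ≤ ℓ → ℓ < L → ∀ h : Fin ℓ → Fin b, ∀ᵐ ω ∂μ ℓ, ∑ c, φ ℓ h c ω = 1)
    (hstep : ∀ ℓ, ℓσ ≤ ℓ → ℓ < L → ∀ (h : Fin ℓ → Fin b) (c : Fin b),
      ∫ ω, ρ (ℓ + 1) (Fin.snoc h c) ω ∂μ (ℓ + 1) = ∫ ω, φ ℓ h c ω * ρ ℓ h ω ∂μ ℓ)
    (hint : ∀ ℓ, ℓσ ≤ ℓ → ℓ < L → ∀ (h : Fin ℓ → Fin b) (c : Fin b),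
      Integrable (fun ω => φ ℓ h c ω * ρ ℓ h ω) (μ ℓ))
    (hstep' : ∀ ℓ, ℓσ + 1 ≤ ℓ → ℓ < L → ∀ (h : Fin ℓ → Fin b) (c : Fin b),
      ∫ ω, ρ' (ℓ + 1) (Fin.snoc h c) ω ∂μ (ℓ + 1) ≤ ∫ ω, φ ℓ h c ω * ρ' ℓ h ω ∂μ ℓ)
    (hint' : ∀ ℓ, ℓσ + 1 ≤ ℓ → ℓ < L → ∀ (h : Fin ℓ → Fin b) (c : Fin b),
      Integrable (fun ω => φ ℓ h c ω * ρ' ℓ h ω) (μ ℓ))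
    (hins : ∀ (h : Fin ℓσ → Fin b) (c : Fin b),
      ∫ ω, ρ' (ℓσ + 1) (Fin.snoc h c) ω ∂μ (ℓσ + 1) ≤ ∫ ω, ψ h c ω * ρ ℓσ h ω ∂μ ℓσ)
    (hψ : ∀ h : Fin ℓσ → Fin b, ∀ᵐ ω ∂μ ℓσ, ∑ c, ψ h c ω ≤ s)
    (hψint : ∀ (h : Fin ℓσ → Fin b) (c : Fin b), Integrable (fun ω => ψ h c ω * ρ ℓσ h ω) (μ ℓσ))
    (hρ0 : ∀ h : Fin ℓσ → Fin b, 0 ≤ᵐ[μ ℓσ] ρ ℓσ h)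
    (hρint : ∀ h : Fin ℓσ → Fin b, Integrable (ρ ℓσ h) (μ ℓσ)) :
    TowerBound s (levelSum (fun ℓ h => ∫ ω, ρ ℓ h ω ∂μ ℓ) L) (levelSum (fun ℓ h => ∫ ω, ρ' ℓ h ω ∂μ ℓ) L) :=
  ⟨b, L, ℓσ, fun ℓ h => ∫ ω, ρ ℓ h ω ∂μ ℓ, fun ℓ h => ∫ ω, ρ' ℓ h ω ∂μ ℓ, hσ,
    conservesOn_integral_ae hunity hstep hint,
    subconservesOn_integral_ae (fun ℓ h₁ h₂ => hunity ℓ (Nat.le_of_succ_le h₁) h₂) hstep' hint',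
    fun h => (sum_le_sum fun c _ => hins h c).trans
      (sum_integral_mul_le_of_le_ae (ψ h) (ρ ℓσ h) (hρ0 h) (hψ h) (hψint h) (hρint h)),
    rfl, le_rfl⟩

end IntegralTowerAE

section Stopped

variable {b : ℕ}

/-- **THE STOPPED SUB-TOWER BOUND** (history-dependent insertion level).  `M` = the run's partial-history masses,
conserving on `[ℓ₁, L)`; `Msib` = the σ-modified masses; `W ℓ h` = the node's status (`true` = WAITING: the slot's
factor is not yet inserted on the partial history `h`; `false` = ACTIVE).  Hypotheses: roots wait (`hroot`); below a
waiting node the children are all waiting or all active (`hpass`), and if active they satisfy THE INSERTION INEQUALITY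
`Σ_c Msib (ℓ+1) (snoc h c) ≤ s · M ℓ h` (`hins`: the inserted factors total `≤ s` against the parent); below an active
node the children are active (`hact`) and sub-conserve (`hsub`: later operations do not increase modified mass); a leaf
still waiting has `Msib ≤ s · M` (`hleaf`; for siblings `Msib = 0 ≤ s · M`).  Conclusion: `levelSum Msib L ≤
s · levelSum M L` — at most one insertion on every root-to-leaf path, wherever it happens.  Proof: the potential
`Φ ℓ h = bif W ℓ h then s · M ℓ h else Msib ℓ h` sub-conserves on `[ℓ₁, L)`, equals `s · M` at the roots and dominates
`Msib` at the leaves.  No smallness, no sign condition on `s`. [folklore] -/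
theorem levelSum_le_of_stoppedInsertion {M Msib : (ℓ : ℕ) → (Fin ℓ → Fin b) → ℝ}
    (W : (ℓ : ℕ) → (Fin ℓ → Fin b) → Bool) {ℓ₁ L : ℕ} {s : ℝ} (hL : ℓ₁ ≤ L) (hM : ConservesOn M ℓ₁ L)
    (hroot : ∀ h : Fin ℓ₁ → Fin b, W ℓ₁ h = true)
    (hpass : ∀ ℓ, ℓ₁ ≤ ℓ → ℓ < L → ∀ h : Fin ℓ → Fin b, W ℓ h = true →
      (∀ c, W (ℓ + 1) (Fin.snoc h c) = true) ∨ (∀ c, W (ℓ + 1) (Fin.snoc h c) = false))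
    (hins : ∀ ℓ, ℓ₁ ≤ ℓ → ℓ < L → ∀ h : Fin ℓ → Fin b, W ℓ h = true → (∀ c, W (ℓ + 1) (Fin.snoc h c) = false) →
      ∑ c : Fin b, Msib (ℓ + 1) (Fin.snoc h c) ≤ s * M ℓ h)
    (hact : ∀ ℓ, ℓ₁ ≤ ℓ → ℓ < L → ∀ h : Fin ℓ → Fin b, W ℓ h = false → ∀ c, W (ℓ + 1) (Fin.snoc h c) = false)
    (hsub : ∀ ℓ, ℓ₁ ≤ ℓ → ℓ < L → ∀ h : Fin ℓ → Fin b, W ℓ h = false →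
      ∑ c : Fin b, Msib (ℓ + 1) (Fin.snoc h c) ≤ Msib ℓ h)
    (hleaf : ∀ h : Fin L → Fin b, W L h = true → Msib L h ≤ s * M L h) :
    levelSum Msib L ≤ s * levelSum M L := by
  -- the potential: `s ×` the run's mass on WAITING nodes, the modified mass on ACTIVE nodes
  have hΦ : SubconservesOn (fun ℓ h => bif W ℓ h then s * M ℓ h else Msib ℓ h) ℓ₁ L := by
    intro ℓ h₁ h₂ h
    show (∑ c, bif W (ℓ + 1) (Fin.snoc h c) then s * M (ℓ + 1) (Fin.snoc h c) else Msib (ℓ + 1) (Fin.snoc h c))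
      ≤ (bif W ℓ h then s * M ℓ h else Msib ℓ h)
    cases hW : W ℓ h with
    | false =>
      -- an active node: children active, modified mass sub-conserves
      have hch := hact ℓ h₁ h₂ h hW
      simp only [hch, cond_false]
      exact hsub ℓ h₁ h₂ h hW
    | true =>
      rcases hpass ℓ h₁ h₂ h hW with hch | hch
      · -- pass-through: children waiting, the run's mass conserves
        simp only [hch, cond_true]
        rw [← mul_sum]
        exact (congrArg (s * ·) (hM ℓ h₁ h₂ h)).symm.le
      · -- the insertion happens here
        simp only [hch, cond_true, cond_false]
        exact hins ℓ h₁ h₂ h hW hch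
  have hroot' : levelSum (fun ℓ h => bif W ℓ h then s * M ℓ h else Msib ℓ h) ℓ₁ = s * levelSum M ℓ₁ := by
    unfold levelSum
    rw [mul_sum]
    exact sum_congr rfl fun h _ => by simp only [hroot h, cond_true]
  have hleaf' : levelSum Msib L ≤ levelSum (fun ℓ h => bif W ℓ h then s * M ℓ h else Msib ℓ h) L := by
    unfold levelSum
    refine sum_le_sum fun h _ => ?_
    show Msib L h ≤ (bif W L h then s * M L h else Msib L h)
    cases hW : W L h with
    | true => exact hleaf h hW
    | false => exact le_rfl
  calc levelSum Msib L ≤ levelSum (fun ℓ h => bif W ℓ h then s * M ℓ h else Msib ℓ h) L := hleaf'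
    _ ≤ levelSum (fun ℓ h => bif W ℓ h then s * M ℓ h else Msib ℓ h) ℓ₁ :=
      levelSum_le_of_subconservesOn hΦ hL
    _ = s * levelSum M ℓ₁ := hroot'
    _ = s * levelSum M L := by rw [levelSum_eq_of_conservesOn hM hL]

/-- CONSISTENCY: v1's fixed-level sub-tower bound `levelSum_le_of_insertion` is the stopped bound for the
history-independent schedule "waiting iff `ℓ ≤ ℓσ`" (insertion at every node of level `ℓσ`). [folklore] -/
theorem levelSum_le_of_insertion_of_stopped {M Msib : (ℓ : ℕ) → (Fin ℓ → Fin b) → ℝ} {ℓσ L : ℕ} {s : ℝ}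
    (hM : ConservesOn M ℓσ L) (hMs : SubconservesOn Msib (ℓσ + 1) L) (hσ : ℓσ < L)
    (hins : ∀ h : Fin ℓσ → Fin b, ∑ c : Fin b, Msib (ℓσ + 1) (Fin.snoc h c) ≤ s * M ℓσ h) :
    levelSum Msib L ≤ s * levelSum M L := by
  refine levelSum_le_of_stoppedInsertion (fun ℓ _ => decide (ℓ ≤ ℓσ)) hσ.le hM (fun _ => decide_eq_true le_rfl)
    (fun ℓ h₁ _ _ _ => Or.inr fun _ => decide_eq_false fun h' => Nat.not_succ_le_self ℓ (h'.trans h₁))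
    (fun ℓ h₁ _ h hW _ => ?_)
    (fun ℓ _ _ _ hW _ => decide_eq_false fun h' => of_decide_eq_false hW (Nat.le_of_succ_le h'))
    (fun ℓ _ h₂ h hW => hMs ℓ (Nat.succ_le_of_lt (not_le.1 (of_decide_eq_false hW))) h₂ h)
    (fun _ hW => absurd (of_decide_eq_true hW) (not_le.2 hσ))
  -- a waiting node of the range sits at level `ℓσ` exactly: the insertion inequality is v1's `hins`
  obtain rfl : ℓ = ℓσ := (of_decide_eq_true hW).antisymm h₁
  exact hins h

/-- The stopped bound in the `TowerBound` FORMAT of §3 (so `siblingSuppression_of_towerBound` and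
`shellWeightBound_of_towerBound` apply verbatim to stopped data). [folklore] -/
theorem towerBound_of_stoppedInsertion {M Msib : (ℓ : ℕ) → (Fin ℓ → Fin b) → ℝ}
    (W : (ℓ : ℕ) → (Fin ℓ → Fin b) → Bool) {ℓ₁ L : ℕ} {s : ℝ} (hL : ℓ₁ ≤ L) (hM : ConservesOn M ℓ₁ L)
    (hroot : ∀ h : Fin ℓ₁ → Fin b, W ℓ₁ h = true)
    (hpass : ∀ ℓ, ℓ₁ ≤ ℓ → ℓ < L → ∀ h : Fin ℓ → Fin b, W ℓ h = true →
      (∀ c, W (ℓ + 1) (Fin.snoc h c) = true) ∨ (∀ c, W (ℓ + 1) (Fin.snoc h c) = false))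
    (hins : ∀ ℓ, ℓ₁ ≤ ℓ → ℓ < L → ∀ h : Fin ℓ → Fin b, W ℓ h = true → (∀ c, W (ℓ + 1) (Fin.snoc h c) = false) →
      ∑ c : Fin b, Msib (ℓ + 1) (Fin.snoc h c) ≤ s * M ℓ h)
    (hact : ∀ ℓ, ℓ₁ ≤ ℓ → ℓ < L → ∀ h : Fin ℓ → Fin b, W ℓ h = false → ∀ c, W (ℓ + 1) (Fin.snoc h c) = false)
    (hsub : ∀ ℓ, ℓ₁ ≤ ℓ → ℓ < L → ∀ h : Fin ℓ → Fin b, W ℓ h = false →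
      ∑ c : Fin b, Msib (ℓ + 1) (Fin.snoc h c) ≤ Msib ℓ h)
    (hleaf : ∀ h : Fin L → Fin b, W L h = true → Msib L h ≤ s * M L h) :
    TowerBound s (levelSum M L) (levelSum Msib L) :=
  towerBound_iff_le.2 (levelSum_le_of_stoppedInsertion W hL hM hroot hpass hins hact hsub hleaf)

open MeasureTheory

variable {Ω : ℕ → Type*} [∀ ℓ, MeasurableSpace (Ω ℓ)] {μ : (ℓ : ℕ) → Measure (Ω ℓ)}
  {ρ ρ' : (ℓ : ℕ) → (Fin ℓ → Fin b) → Ω ℓ → ℝ} {φ : (ℓ : ℕ) → (Fin ℓ → Fin b) → Fin b → Ω ℓ → ℝ}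

/-- **STOPPED INTEGRAL TOWER ⇒ TOWER BOUND** — the Bochner form of `levelSum_le_of_stoppedInsertion` handed to the
`TermRepr`-instantiating seat when the slot's factor enters at a HISTORY-DEPENDENT level: the run's partial integrands
`ρ` with a.e. decompositions of unity and one-step identities on `[ℓ₁, L)` (`hunity`, `hstep`, `hint`); a status `W`
(roots waiting, `hpass`/`hact` as in the discrete form); AT THE INSERTION (parent waiting, children active) the
modification inequality `∫ ρ'(ℓ+1)(h,c) ≤ ∫ ψ_{ℓ,h,c} · ρ ℓ h` with `Σ_c ψ ≤ s` and `0 ≤ ρ ℓ h` `μ ℓ`-a.e. (`hins`, `hψ`,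
`hψint`, `hρ0`, `hρint`); below active nodes the modified one-step inequality (`hstep'`, `hint'`); waiting leaves with
`∫ ρ' ≤ s ∫ ρ` (`hleaf`).  Mechanism (A): `ψ_c` = the polarity shells, `s = 2`. [folklore] -/
theorem towerBound_of_stoppedIntegralTower {ℓ₁ L : ℕ} {s : ℝ} (W : (ℓ : ℕ) → (Fin ℓ → Fin b) → Bool)
    {ψ : (ℓ : ℕ) → (Fin ℓ → Fin b) → Fin b → Ω ℓ → ℝ} (hL : ℓ₁ ≤ L)
    (hunity : ∀ ℓ, ℓ₁ ≤ ℓ → ℓ < L → ∀ h : Fin ℓ → Fin b, ∀ᵐ ω ∂μ ℓ, ∑ c, φ ℓ h c ω = 1)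
    (hstep : ∀ ℓ, ℓ₁ ≤ ℓ → ℓ < L → ∀ (h : Fin ℓ → Fin b) (c : Fin b),
      ∫ ω, ρ (ℓ + 1) (Fin.snoc h c) ω ∂μ (ℓ + 1) = ∫ ω, φ ℓ h c ω * ρ ℓ h ω ∂μ ℓ)
    (hint : ∀ ℓ, ℓ₁ ≤ ℓ → ℓ < L → ∀ (h : Fin ℓ → Fin b) (c : Fin b),
      Integrable (fun ω => φ ℓ h c ω * ρ ℓ h ω) (μ ℓ))
    (hroot : ∀ h : Fin ℓ₁ → Fin b, W ℓ₁ h = true)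
    (hpass : ∀ ℓ, ℓ₁ ≤ ℓ → ℓ < L → ∀ h : Fin ℓ → Fin b, W ℓ h = true →
      (∀ c, W (ℓ + 1) (Fin.snoc h c) = true) ∨ (∀ c, W (ℓ + 1) (Fin.snoc h c) = false))
    (hins : ∀ ℓ, ℓ₁ ≤ ℓ → ℓ < L → ∀ h : Fin ℓ → Fin b, W ℓ h = true → (∀ c, W (ℓ + 1) (Fin.snoc h c) = false) →
      ∀ c, ∫ ω, ρ' (ℓ + 1) (Fin.snoc h c) ω ∂μ (ℓ + 1) ≤ ∫ ω, ψ ℓ h c ω * ρ ℓ h ω ∂μ ℓ)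
    (hψ : ∀ ℓ, ℓ₁ ≤ ℓ → ℓ < L → ∀ h : Fin ℓ → Fin b, W ℓ h = true → ∀ᵐ ω ∂μ ℓ, ∑ c, ψ ℓ h c ω ≤ s)
    (hψint : ∀ ℓ, ℓ₁ ≤ ℓ → ℓ < L → ∀ h : Fin ℓ → Fin b, W ℓ h = true → ∀ c,
      Integrable (fun ω => ψ ℓ h c ω * ρ ℓ h ω) (μ ℓ))
    (hρ0 : ∀ ℓ, ℓ₁ ≤ ℓ → ℓ < L → ∀ h : Fin ℓ → Fin b, W ℓ h = true → 0 ≤ᵐ[μ ℓ] ρ ℓ h)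
    (hρint : ∀ ℓ, ℓ₁ ≤ ℓ → ℓ < L → ∀ h : Fin ℓ → Fin b, W ℓ h = true → Integrable (ρ ℓ h) (μ ℓ))
    (hact : ∀ ℓ, ℓ₁ ≤ ℓ → ℓ < L → ∀ h : Fin ℓ → Fin b, W ℓ h = false → ∀ c, W (ℓ + 1) (Fin.snoc h c) = false)
    (hstep' : ∀ ℓ, ℓ₁ ≤ ℓ → ℓ < L → ∀ h : Fin ℓ → Fin b, W ℓ h = false → ∀ c,
      ∫ ω, ρ' (ℓ + 1) (Fin.snoc h c) ω ∂μ (ℓ + 1) ≤ ∫ ω, φ ℓ h c ω * ρ' ℓ h ω ∂μ ℓ)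
    (hint' : ∀ ℓ, ℓ₁ ≤ ℓ → ℓ < L → ∀ h : Fin ℓ → Fin b, W ℓ h = false → ∀ c,
      Integrable (fun ω => φ ℓ h c ω * ρ' ℓ h ω) (μ ℓ))
    (hleaf : ∀ h : Fin L → Fin b, W L h = true → ∫ ω, ρ' L h ω ∂μ L ≤ s * ∫ ω, ρ L h ω ∂μ L) :
    TowerBound s (levelSum (fun ℓ h => ∫ ω, ρ ℓ h ω ∂μ ℓ) L) (levelSum (fun ℓ h => ∫ ω, ρ' ℓ h ω ∂μ ℓ) L) := by
  refine towerBound_of_stoppedInsertion W hL (conservesOn_integral_ae hunity hstep hint) hroot hpass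
    (fun ℓ h₁ h₂ h hW hch => ?_) hact (fun ℓ h₁ h₂ h hW => ?_) hleaf
  · -- the insertion: `Σ_c ∫ ρ' child ≤ Σ_c ∫ ψ_c ρ parent ≤ s ∫ ρ parent`
    exact (sum_le_sum fun c _ => hins ℓ h₁ h₂ h hW hch c).trans
      (sum_integral_mul_le_of_le_ae (ψ ℓ h) (ρ ℓ h) (hρ0 ℓ h₁ h₂ h hW) (hψ ℓ h₁ h₂ h hW)
        (hψint ℓ h₁ h₂ h hW) (hρint ℓ h₁ h₂ h hW))
  · -- below an active node: a.e. unity + the modified one-step inequality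
    show ∑ c, ∫ ω, ρ' (ℓ + 1) (Fin.snoc h c) ω ∂μ (ℓ + 1) ≤ ∫ ω, ρ' ℓ h ω ∂μ ℓ
    rw [← sum_integral_mul_eq_of_unity_ae (φ ℓ h) (ρ' ℓ h) (hunity ℓ h₁ h₂ h) (hint' ℓ h₁ h₂ h hW)]
    exact sum_le_sum fun c _ => hstep' ℓ h₁ h₂ h hW c

end Stopped

/-! ## §6 [v1.2] The REGENERATED class, priced: young `ℝ`-events under mechanism (B), level by level, and the
one-cube floor (Y)

Appended for GAPS G-ne7bp1g5-1 (t4-ne7b-p1 gen 5; kernel `T4BadClassBooking`, p187370) — CONCEDED by this lineage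
(gen 6): v1.1's exit (B1) cannot hand the ALL-YOUNG `ℝ`-reshaped branches to NE7b
(`T4BadClassBooking.not_relWeightBound_of_saturated`: their relative weight is `K`-uniform, so the field `summable` of
`T4WeightBudget.RelWeightBound` fails for every `W`), hence the regenerated occurrences of header §0(B) at YOUNG
`ℝ`-events ARE priced in the sibling binder — here.  §1–§5 above are v1.1 byte for byte.  All [folklore]; every
`def … : Prop` is a HYPOTHESIS SHAPE of the cell's bookkeeping (NOT PRINTED); nothing of Bałaban's is asserted.

THE ACCOUNTING.  Fix a slot `σ = ⟨a, i⟩`, a cutoff `K`, `|t| ≤ l₀`; `Z = Σ_τ X K t τ`.  The σ-sibling weights split as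
(decomposition occurrences) + Σ_{ℓ ∈ E(σ)} (occurrences regenerated at the later `ℝ`-level `ℓ`), `|E(σ)| ≤ d(a)`
(`d(a) = a` when one `ℝ` acts per step after the slot's level; `d` is kept abstract).  The first part is a tower-bound
datum with the structural constant `s` (§3–§5, mechanism (A)).  AT LEVEL `ℓ` the regenerated family — the `Z`-branches
alive at level `ℓ` with `σ ⊂ Z′`, pushed through the σ-MODIFIED kernel (the slot's substituted factor replaced by its
shell), every later operation unchanged — is ITSELF a tower-bound datum `TowerBound r̄ Z Y_ℓ`: insertion AT LEVEL `ℓ`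
with `ψ_{h,c} = r_Z · φ_c ≤ r̄ · φ_c` on the reshaped choices and `0` elsewhere (`Σ_c ψ ≤ r̄`;
`towerBound_of_integralTower(_ae)` / `towerBound_of_stoppedIntegralTower` verbatim), where
`r_Z(x) = ∫_{Z′} shell_σ · rest″ / ∫_{Z′} p_σ · rest″` is the row sum of the modified kernel (mechanism (B),
`kernelMod_mass_le`).  Hence `Σ_ℓ Y_ℓ ≤ d(a) · r̄ · Z` (`siblingSuppression_of_levelTowerBounds`) and
`S a = s + d(a) · r̄` (`siblingSuppression_of_towerBound_add_levels`): AGE-DEPENDENT, `K`-UNIFORM — all the binder asks.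
THE PRICE is the bound `r_Z ≤ r̄`, i.e. ONE estimate, typed as (Y) `SmallFieldFloor`: `c · ∫_{Z′} rest″ ≤ ∫_{Z′} p_σ · rest″`
with one `c > 0` for all `(K, t, ℓ, Z, σ, x_{Z′ᶜ})`; then `r̄ = 1/c` (`integral_mul_le_inv_floor`: shell `≤ 1`).  (Y) says
that under `ℝ`'s exterior-pinned substituted density on `Z′` the cube `σ` meets its small-field condition with
conditional probability `≥ c` — the conditional, one-cube, lowered-threshold form of the large-field improbability:
printed MECHANISM B15 p. 176 «The quotients are still small, because some small factors in the regions Z′ are left for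
the densities in the numerator.» [render `1989-cmp122-large-field-I-p002`], cell SPECIES E2REL-b / NE7b-at-lowered-
threshold; NOT PRINTED as such; an ESTIMATE, not structure.  The same floor is what the remainder sandwich `hsw` of
`T4LipschitzLedger.core_sandwich` needs for the two-run comparability of `ℝ`'s denominators inside the image / merged
good terms (node U5b/U5c's business, named here only). -/

section Regenerated

variable {ι : Type*} {l₀ : ℝ} {T : ℕ → Finset ι} {A B : ℕ → ℝ → ι → ℝ}

/-- **REGENERATED FAMILIES, LEVEL BY LEVEL ⇒ SIBLING SUPPRESSION `S a = d(a) · r`.**  If for every slot `σ = ⟨a, i⟩`,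
cutoff `K` and `|t| ≤ l₀` the (regenerated part of the) σ-sibling weights are dominated by `Σ_{ℓ ∈ E} Y_ℓ` over a set
`E` of at most `d(a)` levels, each `Y_ℓ` a tower-bound datum against the run's total with the SAME constant `r ≥ 0`
(the bound on the modified kernels' row sums), then `SiblingSuppression` holds with `S a = d(a) · r` — uniformly in `K`
and `t`.  (`0 ≤ Σ_τ X` is the positivity of the run's partition function, `hpos` of `T4LipschitzLedger.cauchy_of_repr`.)
[folklore] -/
theorem siblingSuppression_of_levelTowerBounds {X : ℕ → ℝ → ι → ℝ} {N : ℕ} {n d : ℕ → ℕ}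
    {sibXs : (Σ _ : ℕ, ℕ) → ℕ → ℝ → ι → ℝ} {r : ℝ} (hr : 0 ≤ r)
    (hX : ∀ K t, |t| ≤ l₀ → 0 ≤ ∑ τ ∈ T K, X K t τ)
    (h : ∀ σ ∈ (range (N + 1)).sigma (fun a => range (n a)), ∀ K t, |t| ≤ l₀ →
      ∃ (E : Finset ℕ) (Y : ℕ → ℝ), E.card ≤ d σ.1 ∧ (∀ ℓ ∈ E, TowerBound r (∑ τ ∈ T K, X K t τ) (Y ℓ)) ∧
        ∑ τ ∈ T K, sibXs σ K t τ ≤ ∑ ℓ ∈ E, Y ℓ) :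
    SiblingSuppression l₀ T X N n sibXs (fun a => (d a : ℝ) * r) := by
  intro σ hσ K t ht
  obtain ⟨E, Y, hE, hY, hle⟩ := h σ hσ K t ht
  show _ ≤ (d σ.1 : ℝ) * r * _
  refine hle.trans ?_
  calc ∑ ℓ ∈ E, Y ℓ ≤ ∑ ℓ ∈ E, r * ∑ τ ∈ T K, X K t τ := sum_le_sum fun ℓ hℓ => le_of_towerBound (hY ℓ hℓ)
    _ = (E.card : ℝ) * (r * ∑ τ ∈ T K, X K t τ) := by rw [sum_const, nsmul_eq_mul]
    _ ≤ (d σ.1 : ℝ) * (r * ∑ τ ∈ T K, X K t τ) :=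
        mul_le_mul_of_nonneg_right (Nat.cast_le.2 hE) (mul_nonneg hr (hX K t ht))
    _ = (d σ.1 : ℝ) * r * ∑ τ ∈ T K, X K t τ := by ring

/-- **DECLARED + REGENERATED OCCURRENCES ⇒ `S a = s + d(a) · r`.**  The σ-sibling weights split (up to `≤`) into the
DECOMPOSITION occurrences — one tower-bound datum with the structural constant `s` (mechanism (A), §3–§5) — and the
occurrences REGENERATED at the later `ℝ`-levels — level-wise tower-bound data with the kernel-ratio constant `r`
(mechanism (B)) ⇒ `SiblingSuppression` with `S a = s + d(a) · r` (`siblingSuppression_add`).  This is v1.1's exit (B2)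
made level-wise; it REPLACES exit (B1) (header §0, GAPS G-ne7bp1g5-1). [folklore] -/
theorem siblingSuppression_of_towerBound_add_levels {X : ℕ → ℝ → ι → ℝ} {N : ℕ} {n d : ℕ → ℕ}
    {sibXs sib₁ sib₂ : (Σ _ : ℕ, ℕ) → ℕ → ℝ → ι → ℝ} {s r : ℝ} (hr : 0 ≤ r)
    (hX : ∀ K t, |t| ≤ l₀ → 0 ≤ ∑ τ ∈ T K, X K t τ)
    (h₁ : ∀ σ ∈ (range (N + 1)).sigma (fun a => range (n a)), ∀ K t, |t| ≤ l₀ →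
      TowerBound s (∑ τ ∈ T K, X K t τ) (∑ τ ∈ T K, sib₁ σ K t τ))
    (h₂ : ∀ σ ∈ (range (N + 1)).sigma (fun a => range (n a)), ∀ K t, |t| ≤ l₀ →
      ∃ (E : Finset ℕ) (Y : ℕ → ℝ), E.card ≤ d σ.1 ∧ (∀ ℓ ∈ E, TowerBound r (∑ τ ∈ T K, X K t τ) (Y ℓ)) ∧
        ∑ τ ∈ T K, sib₂ σ K t τ ≤ ∑ ℓ ∈ E, Y ℓ)
    (hle : ∀ σ ∈ (range (N + 1)).sigma (fun a => range (n a)), ∀ K t, |t| ≤ l₀ →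
      ∑ τ ∈ T K, sibXs σ K t τ ≤ ∑ τ ∈ T K, sib₁ σ K t τ + ∑ τ ∈ T K, sib₂ σ K t τ) :
    SiblingSuppression l₀ T X N n sibXs (fun a => s + (d a : ℝ) * r) :=
  siblingSuppression_add (siblingSuppression_of_towerBound h₁) (siblingSuppression_of_levelTowerBounds hr hX h₂) hle

open MeasureTheory

/-- **(Y) THE ONE-CUBE SMALL-FIELD FLOOR** (hypothesis shape, NOT PRINTED; SPECIES = the cell's E2REL-b /
NE7b-at-lowered-threshold template; printed MECHANISM = B15 p. 176 «The quotients are still small, because some small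
factors in the regions Z′ are left for the densities in the numerator.»).  On one fibre — the `Z′`-variables of an
`ℝ`-event with the exterior configuration pinned, measure `ν` — with `g = rest″ ≥ 0` the substituted `Z″`-density
stripped of the slot's factor and `p = p_σ ∈ [0, 1]` that factor: the `p`-weighted mass is at least the fraction `c` of
the total mass, `c · ∫ g ≤ ∫ p · g` — the cube `σ` meets its small-field condition with conditional probability `≥ c`.
An ESTIMATE (a conditional large-field improbability), not structure; used below only as a named binder. [folklore] -/
def SmallFieldFloor {Ω₀ : Type*} [MeasurableSpace Ω₀] (ν : Measure Ω₀) (p g : Ω₀ → ℝ) (c : ℝ) : Prop :=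
  c * ∫ ω, g ω ∂ν ≤ ∫ ω, p ω * g ω ∂ν

/-- The floor is monotone in the constant (for a nonnegative total mass). [folklore] -/
theorem SmallFieldFloor.mono {Ω₀ : Type*} [MeasurableSpace Ω₀] {ν : Measure Ω₀} {p g : Ω₀ → ℝ} {c c' : ℝ}
    (h : SmallFieldFloor ν p g c) (hc : c' ≤ c) (hg : 0 ≤ ∫ ω, g ω ∂ν) : SmallFieldFloor ν p g c' :=
  (mul_le_mul_of_nonneg_right hc hg).trans h

/-- The trivial inhabitant: the factor `p ≡ 1` has floor `c = 1` (non-vacuity of the shape). [folklore] -/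
theorem smallFieldFloor_one {Ω₀ : Type*} [MeasurableSpace Ω₀] (ν : Measure Ω₀) (g : Ω₀ → ℝ) :
    SmallFieldFloor ν (fun _ => 1) g 1 := by
  unfold SmallFieldFloor
  simp

/-- **FLOOR ⇒ KERNEL-RATIO BOUND `r ≤ 1/c`.**  With the floor (Y) at constant `c > 0`, any modification `ψ ≤ 1` a.e.
of the slot's factor (the shell indicators of both polarities qualify: `T4LipschitzLedger.Pol.shell_le_one`) has
`∫ ψ · g ≤ c⁻¹ · ∫ p · g` — the modified kernel's row sum `r_Z(x) = ∫_{Z′} shell_σ·rest″ / ∫_{Z′} p_σ·rest″` is at most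
`r̄ = 1/c`, uniformly in whatever (Y) is uniform in.  This is the `hins` of `towerBound_of_integralTower_ae` at an
`ℝ`-level with `ψ_{h,c} = c⁻¹ · φ_c`, fibre by fibre. [folklore] -/
theorem integral_mul_le_inv_floor {Ω₀ : Type*} [MeasurableSpace Ω₀] {ν : Measure Ω₀} {p ψ g : Ω₀ → ℝ} {c : ℝ}
    (hc : 0 < c) (hfl : SmallFieldFloor ν p g c) (hψ : ∀ᵐ ω ∂ν, ψ ω ≤ 1) (hg : 0 ≤ᵐ[ν] g)
    (hψg : Integrable (fun ω => ψ ω * g ω) ν) (hgi : Integrable g ν) :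
    ∫ ω, ψ ω * g ω ∂ν ≤ c⁻¹ * ∫ ω, p ω * g ω ∂ν := by
  have h1 : ∫ ω, ψ ω * g ω ∂ν ≤ ∫ ω, g ω ∂ν := by
    refine integral_mono_ae hψg hgi ?_
    filter_upwards [hψ, hg] with ω hψω hgω
    calc ψ ω * g ω ≤ 1 * g ω := mul_le_mul_of_nonneg_right hψω hgω
      _ = g ω := one_mul _
  have h2 : ∫ ω, g ω ∂ν ≤ c⁻¹ * ∫ ω, p ω * g ω ∂ν := by
    have := mul_le_mul_of_nonneg_left hfl (inv_nonneg.2 hc.le)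
    rwa [inv_mul_cancel_left₀ hc.ne'] at this
  exact h1.trans h2

/-- **(Y) UNIFORMLY** over an index `J` of fibres (in the cell: `(K, t, ℓ, history, σ, x_{Z′ᶜ})`, each with its own
`Z′`-space): ONE constant `c > 0` for all fibres.  Hypothesis shape, NOT PRINTED; the `K`-uniformity is the content
(under cell reading U5a the young levels' couplings are `K`-independent). [folklore] -/
def UniformSmallFieldFloor {J : Type*} {Ω₀ : J → Type*} [∀ j, MeasurableSpace (Ω₀ j)]
    (ν : (j : J) → Measure (Ω₀ j)) (p g : (j : J) → Ω₀ j → ℝ) (c : ℝ) : Prop :=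
  0 < c ∧ ∀ j, SmallFieldFloor (ν j) (p j) (g j) c

/-- Uniform floor ⇒ the uniform row-sum bound `r̄ = c⁻¹` on every fibre. [folklore] -/
theorem UniformSmallFieldFloor.integral_mul_le {J : Type*} {Ω₀ : J → Type*} [∀ j, MeasurableSpace (Ω₀ j)]
    {ν : (j : J) → Measure (Ω₀ j)} {p g : (j : J) → Ω₀ j → ℝ} {c : ℝ} (h : UniformSmallFieldFloor ν p g c)
    {j : J} {ψ : Ω₀ j → ℝ} (hψ : ∀ᵐ ω ∂ν j, ψ ω ≤ 1) (hg : 0 ≤ᵐ[ν j] g j)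
    (hψg : Integrable (fun ω => ψ ω * g j ω) (ν j)) (hgi : Integrable (g j) (ν j)) :
    ∫ ω, ψ ω * g j ω ∂ν j ≤ c⁻¹ * ∫ ω, p j ω * g j ω ∂ν j :=
  integral_mul_le_inv_floor h.1 (h.2 j) hψ hg hψg hgi

/-- **THE (η) CONSTRUCTOR WITH THE REGENERATED CLASS PRICED.**  Two Lipschitz slot ledgers; for both runs, per slot:
a tower-bound datum with the structural constant `s ≥ 0` for the decomposition occurrences, level-wise tower-bound data
with constant `r ≥ 0` (`= c⁻¹` from (Y)) over at most `d(a)` later `ℝ`-levels for the regenerated ones, and the split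
of the sibling weights; a nonnegative SUMMABLE two-run width `ρ`; the union bounds ⇒ the literal
`T4IndicatorShell.ShellWeightBound` with band weight `K ↦ Σ_{a ≤ N} n_a · lipWeight L (fun a ↦ s + d(a)·r) ρ a K`.
(`shellWeightBound_of_lipProfile` with both `SiblingSuppression` binders discharged by
`siblingSuppression_of_towerBound_add_levels`.) [folklore] -/
theorem shellWeightBound_of_towerBound_add_levels {N : ℕ} {n d : ℕ → ℕ}
    {shAs sibAs sibA₁ sibA₂ shBs sibBs sibB₁ sibB₂ : (Σ _ : ℕ, ℕ) → ℕ → ℝ → ι → ℝ} {Lχ ρ : ℕ → ℝ} {s r : ℝ}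
    {shA shB : ℕ → ℝ → ι → ℝ}
    (hLA : LipSlotLedger l₀ T A N n shAs sibAs Lχ ρ) (hLB : LipSlotLedger l₀ T B N n shBs sibBs Lχ ρ)
    (hZA : ∀ K t, |t| ≤ l₀ → 0 ≤ ∑ τ ∈ T K, A K t τ) (hZB : ∀ K t, |t| ≤ l₀ → 0 ≤ ∑ τ ∈ T K, B K t τ)
    (hTA : ∀ σ ∈ (range (N + 1)).sigma (fun a => range (n a)), ∀ K t, |t| ≤ l₀ →
      TowerBound s (∑ τ ∈ T K, A K t τ) (∑ τ ∈ T K, sibA₁ σ K t τ))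
    (hRA : ∀ σ ∈ (range (N + 1)).sigma (fun a => range (n a)), ∀ K t, |t| ≤ l₀ →
      ∃ (E : Finset ℕ) (Y : ℕ → ℝ), E.card ≤ d σ.1 ∧ (∀ ℓ ∈ E, TowerBound r (∑ τ ∈ T K, A K t τ) (Y ℓ)) ∧
        ∑ τ ∈ T K, sibA₂ σ K t τ ≤ ∑ ℓ ∈ E, Y ℓ)
    (hleA : ∀ σ ∈ (range (N + 1)).sigma (fun a => range (n a)), ∀ K t, |t| ≤ l₀ →
      ∑ τ ∈ T K, sibAs σ K t τ ≤ ∑ τ ∈ T K, sibA₁ σ K t τ + ∑ τ ∈ T K, sibA₂ σ K t τ)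
    (hTB : ∀ σ ∈ (range (N + 1)).sigma (fun a => range (n a)), ∀ K t, |t| ≤ l₀ →
      TowerBound s (∑ τ ∈ T K, B K t τ) (∑ τ ∈ T K, sibB₁ σ K t τ))
    (hRB : ∀ σ ∈ (range (N + 1)).sigma (fun a => range (n a)), ∀ K t, |t| ≤ l₀ →
      ∃ (E : Finset ℕ) (Y : ℕ → ℝ), E.card ≤ d σ.1 ∧ (∀ ℓ ∈ E, TowerBound r (∑ τ ∈ T K, B K t τ) (Y ℓ)) ∧
        ∑ τ ∈ T K, sibB₂ σ K t τ ≤ ∑ ℓ ∈ E, Y ℓ)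
    (hleB : ∀ σ ∈ (range (N + 1)).sigma (fun a => range (n a)), ∀ K t, |t| ≤ l₀ →
      ∑ τ ∈ T K, sibBs σ K t τ ≤ ∑ τ ∈ T K, sibB₁ σ K t τ + ∑ τ ∈ T K, sibB₂ σ K t τ)
    (hL : ∀ a ≤ N, 0 ≤ Lχ a) (hs : 0 ≤ s) (hr : 0 ≤ r) (hρ0 : ∀ j, 0 ≤ ρ j) (hρ : Summable ρ)
    (hA0 : ∀ K t, |t| ≤ l₀ → ∀ τ ∈ T K, 0 ≤ shA K t τ) (hAle : ∀ K t, |t| ≤ l₀ → ∀ τ ∈ T K, shA K t τ ≤ A K t τ)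
    (hAu : ∀ K t, |t| ≤ l₀ → ∀ τ ∈ T K,
      shA K t τ ≤ ∑ σ ∈ (range (N + 1)).sigma (fun a => range (n a)), shAs σ K t τ)
    (hB0 : ∀ K t, |t| ≤ l₀ → ∀ τ ∈ T K, 0 ≤ shB K t τ) (hBle : ∀ K t, |t| ≤ l₀ → ∀ τ ∈ T K, shB K t τ ≤ B K t τ)
    (hBu : ∀ K t, |t| ≤ l₀ → ∀ τ ∈ T K,
      shB K t τ ≤ ∑ σ ∈ (range (N + 1)).sigma (fun a => range (n a)), shBs σ K t τ) :
    ShellWeightBound l₀ T A B shA shB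
      (fun K => ∑ a ∈ range (N + 1), (n a : ℝ) * lipWeight Lχ (fun a => s + (d a : ℝ) * r) ρ a K) :=
  shellWeightBound_of_lipProfile hLA hLB (siblingSuppression_of_towerBound_add_levels hr hZA hTA hRA hleA)
    (siblingSuppression_of_towerBound_add_levels hr hZB hTB hRB hleB) hL
    (fun _ _ => add_nonneg hs (mul_nonneg (Nat.cast_nonneg _) hr)) hρ0 hρ hA0 hAle hAu hB0 hBle hBu

/-- **THE TOTAL WITH THE REGENERATED CLASS PRICED:** `Σ_K Wsh_K = C₀(n, L·S) · Σ_j ρ_j` with `S a = s + d(a)·r` — an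
AGE-WEIGHTED window constant times the total two-run width; STILL no suppression exponent and no
`T4ShellCount.LevelGain`: the summability of the shell weights remains the summability of `ρ` alone; (Y) moves a
CONSTANT. [folklore] -/
theorem tsum_weight_add_levels {N : ℕ} (n d : ℕ → ℕ) (Lχ : ℕ → ℝ) (s r : ℝ) {ρ : ℕ → ℝ} (hρ : Summable ρ) :
    ∑' K, (∑ a ∈ range (N + 1), (n a : ℝ) * lipWeight Lχ (fun a => s + (d a : ℝ) * r) ρ a K)
      = C0 N (fun a => (n a : ℝ)) (fun a => Lχ a * (s + (d a : ℝ) * r)) * ∑' j, ρ j :=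
  tsum_weight_eq n Lχ _ hρ

/-- With the printed cube count: `Σ_K Wsh_K ≤ V · Σ_{a ≤ N} Λ^a L(a) (s + d(a)·r) · Σ_j ρ_j`. [folklore] -/
theorem tsum_weight_add_levels_le_of_cubeCount {N : ℕ} {n d : ℕ → ℕ} {V Λ : ℝ} {Lχ ρ : ℕ → ℝ} {s r : ℝ}
    (hc : CubeCount N n V Λ) (hL : ∀ a ≤ N, 0 ≤ Lχ a) (hs : 0 ≤ s) (hr : 0 ≤ r) (hρ0 : ∀ j, 0 ≤ ρ j)
    (hρ : Summable ρ) :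
    ∑' K, (∑ a ∈ range (N + 1), (n a : ℝ) * lipWeight Lχ (fun a => s + (d a : ℝ) * r) ρ a K)
      ≤ (V * ∑ a ∈ range (N + 1), Λ ^ a * (Lχ a * (s + (d a : ℝ) * r))) * ∑' j, ρ j := by
  rw [tsum_weight_add_levels n d Lχ s r hρ]
  exact mul_le_mul_of_nonneg_right
    (C0_le_of_cubeCount' hc fun a ha => mul_nonneg (hL a ha) (add_nonneg hs (mul_nonneg (Nat.cast_nonneg _) hr)))
    (tsum_nonneg hρ0)

/-- CONSISTENCY with v1: with NO regenerated levels (`d ≡ 0`, or `r = 0`) the priced constructor's sibling factor is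
v1's constant `s` (`shellWeightBound_of_towerBound`). [folklore] -/
theorem lipWeight_add_levels_zero (Lχ ρ : ℕ → ℝ) (s : ℝ) (d : ℕ → ℕ) (a K : ℕ) :
    lipWeight Lχ (fun a => s + (d a : ℝ) * 0) ρ a K = lipWeight Lχ (fun _ => s) ρ a K := by
  simp [lipWeight]

end Regenerated

/-! ## §7 [v1.3] The fibrewise floor's domain of validity (CONTACT SLOTS) and the x-AVERAGED producer for `hins`

APPEND-ONLY section (generation 11), requested by the node owner (pv07-g17; header, v1.3 paragraph).  It is this lineage's
generation-10 scratch kernel (`HOME/t4/b2b-balaban-t4-ne7c-p2/g10/g10-contact.lean`, sha256-16 `7494cdaa21236611`) carried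
over VERBATIM MODULO NAMING (namespace; section names); all [folklore]; nothing of [B11]–[B15] asserted.

WHAT IT RECORDS.  (1) `smallFieldFloor_le_of_profile_le`, `not_uniformSmallFieldFloor_of_vanishing_profiles`: the floor
(Y) of §6 read FIBREWISE AND UNIFORMLY (`UniformSmallFieldFloor`: one `c > 0` for every fibre `j`, i.e. for every exterior
pinning) fails as soon as the fibre family contains, for every `η > 0`, a fibre of positive `rest″`-mass on which the slot's
factor is `≤ η` pointwise.  In the cell's cube model of the regenerated factors (a slot `σ` with a `[0,1]`-valued profile
`p_σ` reading the plaquettes of a neighbourhood `□~(σ)`, ramp width `Δ`, admissible exteriors pinned up to `δ′` below the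
threshold) this is exactly a CONTACT slot (`□~(σ) ⊄ Z′`): the exterior pinned within `δ′` of the threshold on a read
plaquette forces `p_σ ≤ 2δ′/Δ` on the whole fibre — the owner's ACCEPTED finding (F1) (GAPS G-pv07-9 ⟦UPDATE pv07-g17⟧).
(2) `WeightedSmallFieldFloor` (hypothesis shape, NOT PRINTED): the floor with its constant scaled by a weight `w` — at a
contact slot `w = ` the pinned contact cubes' own factor; `WeightedSmallFieldFloor.integral_mul_le`: row sum `≤ (w·c)⁻¹`.
(3) `ratio_le_inv_of_weightedFloor`, `integral_mass_ratio_le_of_weightedFloor`: what the tower CONSUMES is the x-INTEGRATED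
insertion hypothesis `hins` of `towerBound_of_integralTower_ae` (§5); model-free over an exterior space `(X, m)` with, per
exterior `x`, `N x = ∫ shell·rest″ ≤ T x = ∫ rest″`, `D x = ∫ p·rest″ > 0` (the normalising denominator), `M x ≥ 0` the
branch's numerator mass and `w x ∈ (0, 1]`: the weighted floor `w·c·T ≤ D` for every `x` AND the AVERAGED CONTACT BOUND
`∫ M/w dm ≤ C·∫ M dm` (hypothesis shape, NOT PRINTED: «removing the contact cubes' factors costs a factor `C` on
`m`-average» — a large-field improbability for the contact cubes under the branch density, AVERAGED over the exterior; the
owner books it as species E2REL-b, B15 p. 176 «The quotients are still small, because some small factors in the regions Z′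
are left for the densities in the numerator.» read on average) give `∫ M·(N/D) dm ≤ (C/c)·∫ M dm`, i.e. `hins` with
`r̄ = C/c`; the last control `example` (`w ≡ 1`, `C = 1`) returns the fibrewise floor's `r̄ = 1/c` of §6
(`integral_mul_le_inv_floor`), so (Y) is the special case and NOTHING of §6 is withdrawn: (Y) stays the served producer on
fibres where it holds (the owner's SCREENED class), §7 is the producer where it cannot (the owner's CONTACT class (v)).

WHAT IT DOES NOT DECIDE (reading question Qσ, GAPS G-ne7cp2-8d / C-ne7cp2-20; the ruling is the owner's / the U5 referee's).
Whether the factors regenerated by `ℝ`'s normalising kernels include contact slots at all depends on WHICH small-field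
functions the realized kernel carries.  Printed loci (quoted for their DEFINITIONS / IDENTITIES only; journal page = render
`1989-cmp122-large-field-I-pNNN-x2.png` with NNN = page − 174): B15 p. 177 «in (0.3), (0.5) we take the denominators equal
not the integrals of the whole densities ρ(Z″, V), but to the integrals of some parts of these densities. More precisely, we
take the parts localized in neighborhoods of the domains Z′, so they do not depend on the large field regions Z″, and they
are determined by small field effective actions only.»; p. 192, after (1.73) `Λ = (Ω^{~4}_{k₀+1})ᶜ ∩ Z`: «The domain Λ plays a
fundamental role in the definition of the ℝ-operation, it is the domain on which we integrate out all field variables.»;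
p. 193, on the function `χ_{k,Λ}` of (1.75): «The restriction introduced by this function is on the field V_k⌈_{Z∩Λᶜ}
only.»; p. 198, on the cumulative small-field functions `χ″_k` of (1.24) inside `Z`: «Now we prove that, with the new
functions introduced in the integral, we can drop the function χ″_k», completed on p. 200: «hence χ″_k = 1, and the equality
(1.89) is proved.»; p. 201, the localized expression (1.100) of `ℝ′` with its small-field function (1.101)
«χ(Λ_i) = χ({|(1/i) log V′(b)| < M₀ε_k for b∈Λ_i})».  This seat's READING of those loci (R-Qσ, GAPS C-ne7cp2-20 — offered to
the owner and the referee, NOT a ruling, NOT a fact of this file): (1.101) is a BOND-wise condition on the gauge-fixed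
FLUCTUATION field `V′` over the bonds of `Λ_i`; the exterior configuration enters the quotient of (1.100) through the
background minimizer `V_{Λ_i}` of Proposition 1 (p. 194) inside the action, and through `χ_{k,Λ_i}`, which stands OUTSIDE
the quotient; on that form the kernel would read no exterior plaquette through a characteristic function and the cube
model's contact class would be EMPTY for it, whereas on the introduction's form (0.3) read literally (the `Z″`-history's own
cube factors on `Z′`) the class is inhabited by the boundary cubes of `Z′`.  The «next paper» announced on p. 202 ([B16],
large field II: the localization / exponentiation (0.5)–(0.6)) was NOT read by this seat.  Which form the cell's `TermRepr`
instantiation models is for its owner to say; this section serves both (with `w ≡ 1`, `C = 1` it is §6).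

One-writer note for §7: `T4TermReprCoupling` / `T4AveragingDisintegration` / `T4WindowLevelShift` / `t4/T4-EST-U5bE2.md`
(pv07) and `T4SmallFieldFloorCount` / `T4SmallFieldFloorMoment` / `T4SmallFieldFloorBlockCount` (this lineage; they import
this file) are named in prose only; nothing is imported from them. -/

section Contact

open MeasureTheory

/-- If the slot's factor is pointwise `≤ η` on a fibre of positive total mass, every floor constant is `≤ η`. [folklore] -/
theorem smallFieldFloor_le_of_profile_le {Ω₀ : Type*} [MeasurableSpace Ω₀] {ν : Measure Ω₀} {p g : Ω₀ → ℝ}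
    {c η : ℝ} (hfl : SmallFieldFloor ν p g c) (hp : ∀ ω, p ω ≤ η) (hg : ∀ ω, 0 ≤ g ω)
    (hgi : Integrable g ν) (hpg : Integrable (fun ω => p ω * g ω) ν) (hpos : 0 < ∫ ω, g ω ∂ν) : c ≤ η := by
  have h : ∫ ω, p ω * g ω ∂ν ≤ η * ∫ ω, g ω ∂ν := by
    rw [← integral_const_mul]
    exact integral_mono hpg (hgi.const_mul η) (fun ω => mul_le_mul_of_nonneg_right (hp ω) (hg ω))
  exact le_of_mul_le_mul_right (hfl.trans h) hpos

/-- **CONTACT-SLOT CARICATURE.**  If for every `η > 0` some fibre of positive mass has its slot factor `≤ η` pointwise,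
`UniformSmallFieldFloor ν p g c` fails for EVERY `c`. [folklore] -/
theorem not_uniformSmallFieldFloor_of_vanishing_profiles {J : Type*} {Ω₀ : J → Type*}
    [∀ j, MeasurableSpace (Ω₀ j)] {ν : (j : J) → Measure (Ω₀ j)} {p g : (j : J) → Ω₀ j → ℝ}
    (hg : ∀ j ω, 0 ≤ g j ω) (hgi : ∀ j, Integrable (g j) (ν j))
    (hpg : ∀ j, Integrable (fun ω => p j ω * g j ω) (ν j)) (hpos : ∀ j, 0 < ∫ ω, g j ω ∂ν j)
    (hvan : ∀ η : ℝ, 0 < η → ∃ j, ∀ ω, p j ω ≤ η) (c : ℝ) : ¬ UniformSmallFieldFloor ν p g c := by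
  rintro ⟨hc, hfl⟩
  obtain ⟨j, hj⟩ := hvan (c / 2) (by positivity)
  have := smallFieldFloor_le_of_profile_le (hfl j) hj (hg j) (hgi j) (hpg j) (hpos j)
  linarith

/-- **WEIGHTED (CONTACT) FLOOR** — the shape that survives at a contact slot: the floor constant carries the exterior's
own profile value `w ∈ (0, 1]` (in the cell: `w = p_{σ″}(x)` of the pinned contact cube; `c(x) ≍ w(x)`).  Hypothesis
shape only; NOT PRINTED. [folklore] -/
def WeightedSmallFieldFloor {Ω₀ : Type*} [MeasurableSpace Ω₀] (ν : Measure Ω₀) (p g : Ω₀ → ℝ) (w c : ℝ) : Prop :=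
  SmallFieldFloor ν p g (w * c)

/-- Weighted floor ⇒ row-sum bound `r ≤ (w·c)⁻¹` (by `integral_mul_le_inv_floor`). [folklore] -/
theorem WeightedSmallFieldFloor.integral_mul_le {Ω₀ : Type*} [MeasurableSpace Ω₀] {ν : Measure Ω₀}
    {p ψ g : Ω₀ → ℝ} {w c : ℝ} (hw : 0 < w) (hc : 0 < c) (hfl : WeightedSmallFieldFloor ν p g w c)
    (hψ : ∀ᵐ ω ∂ν, ψ ω ≤ 1) (hg : 0 ≤ᵐ[ν] g) (hψg : Integrable (fun ω => ψ ω * g ω) ν) (hgi : Integrable g ν) :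
    ∫ ω, ψ ω * g ω ∂ν ≤ (w * c)⁻¹ * ∫ ω, p ω * g ω ∂ν :=
  integral_mul_le_inv_floor (mul_pos hw hc) hfl hψ hg hψg hgi

section ContactControls

/-- The caricature inhabited: fibres `n : ℕ` = «exterior pinned at `Δ/(n+1)` below threshold on a read plaquette»;
one-point fibre, unit rest″-mass, slot factor `≡ 1/(n+1)`.  No `c` is a uniform floor. -/
example (c : ℝ) : ¬ UniformSmallFieldFloor (fun _ : ℕ => (Measure.dirac () : Measure Unit))
    (fun n _ => (1 : ℝ) / (n + 1)) (fun _ _ => (1 : ℝ)) c := by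
  refine not_uniformSmallFieldFloor_of_vanishing_profiles
    (ν := fun _ : ℕ => (Measure.dirac () : Measure Unit)) (p := fun n _ => (1 : ℝ) / (n + 1))
    (g := fun _ _ => (1 : ℝ)) (fun _ _ => zero_le_one) (fun _ => integrable_const _)
    (fun _ => integrable_const _) (fun _ => by simp) ?_ c
  intro η hη
  obtain ⟨n, hn⟩ := exists_nat_gt (1 / η)
  refine ⟨n, fun _ => ?_⟩
  have hn' : (0 : ℝ) < n + 1 := by positivity
  rw [div_le_iff₀ hn']
  have h1 : 1 / η < n + 1 := hn.trans (by linarith)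
  have h2 := (div_lt_iff₀ hη).1 h1
  linarith

/-- …while EACH fibre alone has a floor (the constant is fibre-dependent: `c_n = 1/(n+1)`), so the failure is exactly the
UNIFORMITY over the exterior pinning. -/
example (n : ℕ) : SmallFieldFloor (Measure.dirac () : Measure Unit) (fun _ => (1 : ℝ) / (n + 1)) (fun _ => 1)
    ((1 : ℝ) / (n + 1)) := by
  unfold SmallFieldFloor
  simp

/-- Weighted floor inhabited on the same fibre with `w = 1/(n+1)`, `c = 1`: the contact cube's own factor IS the floor. -/
example (n : ℕ) : WeightedSmallFieldFloor (Measure.dirac () : Measure Unit) (fun _ => (1 : ℝ) / (n + 1))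
    (fun _ => 1) ((1 : ℝ) / (n + 1)) 1 := by
  unfold WeightedSmallFieldFloor SmallFieldFloor
  simp

end ContactControls


section Averaged

/-! ### What the tower actually consumes: the x-INTEGRATED row-sum bound (`hins` of
`towerBound_of_integralTower_ae`), fed at contact slots by the WEIGHTED floor + an AVERAGED contact bound

Model-free bookkeeping over the exterior space `(X, m)`: per exterior `x`, `N x = ∫ shell_σ·rest″`, `T x = ∫ rest″`,
`D x = ∫ p_σ·rest″ > 0` (the `ℝ`-denominator), `M x ≥ 0` the branch's numerator mass, `w x ∈ (0,1]` the contact weight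
(the pinned contact cubes' own profile values).  The regenerated sibling's total mass is `∫ M·(N/D) dm` (B15 (0.3) read
branch-wise); the tower's `hins` wants it `≤ r̄·∫ M dm`.  Sufficient: the weighted floor `w·c·T ≤ D` fibrewise AND the
averaged bound `∫ M/w ≤ C·∫ M` («removing the contact cubes' factors costs a factor C on m-average» — a LARGE-FIELD
improbability for the contact cubes under the branch density, AVERAGED over the exterior: print's B15 p. 176 mechanism,
species E2REL-b; NOT PRINTED for these densities; a binder).  Then `r̄ = C/c`. -/

/-- Per exterior: shell `≤` total and the weighted floor give the row-sum bound `N/D ≤ (w·c)⁻¹`. [folklore] -/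
theorem ratio_le_inv_of_weightedFloor {N T D w c : ℝ} (hw : 0 < w) (hc : 0 < c) (hD : 0 < D) (hN : N ≤ T)
    (hfl : w * c * T ≤ D) : N / D ≤ (w * c)⁻¹ := by
  have hwc : 0 < w * c := mul_pos hw hc
  rw [div_le_iff₀ hD, inv_mul_eq_div, le_div_iff₀ hwc]
  calc N * (w * c) ≤ T * (w * c) := mul_le_mul_of_nonneg_right hN hwc.le
    _ = w * c * T := by ring
    _ ≤ D := hfl

/-- **CONTACT SLOTS FEED `hins` ON `x`-AVERAGE.**  Weighted floor fibrewise + averaged contact bound ⇒ the regenerated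
sibling's mass is at most `(C/c)·` the branch mass. [folklore] -/
theorem integral_mass_ratio_le_of_weightedFloor {X : Type*} [MeasurableSpace X] {m : Measure X}
    {M N D T w : X → ℝ} {c C : ℝ} (hc : 0 < c) (hM : ∀ x, 0 ≤ M x) (hN0 : ∀ x, 0 ≤ N x) (hw : ∀ x, 0 < w x)
    (hD : ∀ x, 0 < D x) (hN : ∀ x, N x ≤ T x) (hfl : ∀ x, w x * c * T x ≤ D x)
    (hMw : Integrable (fun x => M x / w x) m) (havg : ∫ x, M x / w x ∂m ≤ C * ∫ x, M x ∂m) :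
    ∫ x, M x * (N x / D x) ∂m ≤ C / c * ∫ x, M x ∂m := by
  have hpt : ∀ x, M x * (N x / D x) ≤ c⁻¹ * (M x / w x) := by
    intro x
    have h1 := ratio_le_inv_of_weightedFloor (hw x) hc (hD x) (hN x) (hfl x)
    calc M x * (N x / D x) ≤ M x * (w x * c)⁻¹ := mul_le_mul_of_nonneg_left h1 (hM x)
      _ = c⁻¹ * (M x / w x) := by rw [mul_inv, div_eq_mul_inv]; ring
  calc ∫ x, M x * (N x / D x) ∂m ≤ ∫ x, c⁻¹ * (M x / w x) ∂m :=
        integral_mono_of_nonneg (ae_of_all _ fun x => mul_nonneg (hM x) (div_nonneg (hN0 x) (hD x).le))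
          (hMw.const_mul _) (ae_of_all _ hpt)
    _ = c⁻¹ * ∫ x, M x / w x ∂m := integral_const_mul _ _
    _ ≤ c⁻¹ * (C * ∫ x, M x ∂m) := mul_le_mul_of_nonneg_left havg (inv_nonneg.2 hc.le)
    _ = C / c * ∫ x, M x ∂m := by rw [div_eq_mul_inv]; ring

/-- Control: with no contact (`w ≡ 1`) the averaged bound holds with `C = 1` and the conclusion is the fibrewise
floor's `r̄ = 1/c` — the uniform floor (Y) is the special case. -/
example {X : Type*} [MeasurableSpace X] {m : Measure X} {M N D T : X → ℝ} {c : ℝ} (hc : 0 < c)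
    (hM : ∀ x, 0 ≤ M x) (hN0 : ∀ x, 0 ≤ N x) (hD : ∀ x, 0 < D x) (hN : ∀ x, N x ≤ T x)
    (hfl : ∀ x, c * T x ≤ D x) (hMi : Integrable M m) :
    ∫ x, M x * (N x / D x) ∂m ≤ 1 / c * ∫ x, M x ∂m := by
  have h := integral_mass_ratio_le_of_weightedFloor (w := fun _ => (1 : ℝ)) (C := 1) hc hM hN0
    (fun _ => one_pos) hD hN (fun x => by simpa using hfl x) (by simpa using hMi) (by simp)
  simpa using h

end Averaged

end Contact

end Literature.MathematicalPhysics.QuantumFieldTheory.Balaban1983to89.T4SiblingInsertion
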